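import Literature.MathematicalPhysics.QuantumLattice.FermiRG.FST2Regularity
import Mathlib.Analysis.Convex.Gauge
import Mathlib.Analysis.Calculus.ImplicitContDiff
import Mathlib.MeasureTheory.Integral.IntervalIntegral.FundThmCalculus
import Mathlib.MeasureTheory.Integral.IntervalIntegral.Periodic
import Mathlib.Analysis.Calculus.Deriv.Inverse
import Mathlib.Analysis.Calculus.Deriv.MeanValue
import Mathlib.Analysis.Calculus.Deriv.Shift
import Mathlib.Analysis.Calculus.DerivativeTest
import Mathlib.Analysis.LocallyConvex.Separation
import Mathlib.Analysis.InnerProductSpace.Calculus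
import Mathlib.Analysis.SpecialFunctions.Complex.Arg
import Mathlib.Analysis.SpecialFunctions.Trigonometric.Deriv
import HarnessLib

/-!
# Feldman–Salmhofer–Trubowitz II: the angular coordinate `θ` on the Fermi curve (`d = 2`) exists

Topic `Literature/MathematicalPhysics/QuantumLattice/FermiRG`. A PROOF COMPANION (theorems only: no
definitions, no named facts) of the frozen hypothesis files `FST2Hypotheses.lean` (gate-hubbard-kl wave
file F4a) and `FST2Regularity.lean` (F4b). Source:

* [II] J. Feldman, M. Salmhofer, E. Trubowitz, *Perturbation theory around non-nested Fermi surfaces II.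
  Regularity of the moving Fermi surface: RPA contributions*, Comm. Pure Appl. Math. **51** (1998)
  1133–1246, arXiv:cond-mat/9701073 (`FeldmanSalmhoferTrubowitz1998`); locators `p.N Lm` = chunk
  `pNNNN.txt`, line `m`, of the `lit read arxiv:cond-mat/9701073` render of the arXiv TeX.

## What is proved

`FST2Hypotheses.FermiCurveParam cr e` records the angular coordinate of [II] §2.2 for `d = 2` as DATA: a
`2π`-periodic parametrisation `θ ↦ p(0,θ)` of the representatives `S ∩ F` of the Fermi curve, injective on
a period, differentiable with velocity of constant length `1/P` (p.9 L67–71: "we take the variable `θ̃` and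
choose `P` such that the period is `2π` … `θ ∈ ℝ/2πℤ`, `|∂_θ p(0,θ)| = 1/P`"). The asymmetric hypothesis
(A4′) and the curvature ratio `antipodeAngularDeriv` are typed over this datum. [II] obtains it from the
tubular coordinates `(ρ,θ)` of [I, Lemma 2.1] around the curve `S` ("(A3) implies that `S` bounds a
strictly convex set. In two dimensions, `S` is a simple closed curve", p.7 L60–62) followed by the change
of variables `θ̃(θ) = P ∫_{θ₀}^{θ} v(0,ϑ) dϑ`, `v = |∂_θ p|` (p.9 L40–66: "a diffeomorphism because
`v(0,θ) > 0` … `|∂_θ̃ p̃(0,θ̃)| = 1/P` for all `θ̃`"). This file proves that the datum EXISTS under the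
typed hypotheses:

* `nonempty_fermiCurveParam`: `finrank ℝ E = 2`, (A2)_{k,h} with `k ≥ 1` (`e ∈ C¹`, `∇e ≠ 0` on `S`) and
  the global half of (A3) (`HypA3Global cr e`: `S ∩ F = ∂C` for ONE compact strictly convex body `C`
  with non-empty interior) give `Nonempty (FermiCurveParam cr e)`; `nonempty_fermiCurveParam_of_hypA2_two`
  is the case (A2)_{2,0} of Theorems 1.1 and 1.2 (i).
* `exists_constSpeed_param_frontier`: the underlying statement of planar geometry — the boundary of a
  compact convex body with interior, cut out by a `C¹` equation `e = 0` with `∇e ≠ 0` on the boundary,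
  is a closed regular `C¹` curve: `2π`-periodic, injective on `[0, 2π)` onto `∂C`, with continuous
  velocity of constant length `1/P`.
* `exists_contDiff_constSpeed_param_frontier`, `exists_constSpeed_reparam_contDiff`,
  `exists_fermiCurveParam_contDiff`: the same curve is `C^k` when `e ∈ C^k` (p.8 L94–98 "the map
  `(ρ,θ) ↦ p(ρ,θ)` … is `C^k` in both variables"; p.9 L52–53 "no differentiability is lost by this change
  of variables": the inverse of `θ̃(θ) = P ∫ v` is `C^k` by the bootstrap `τ' = P⁻¹/‖γ₀' ∘ τ‖`).
* `inner_gradient_eq_zero_of_apply_comp_eq_zero`, `hessQuad_add_inner_gradient_eq_zero`: the identities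
  (Trick) of the proof of Lemma 2.1 (p.9 L13–18): `∇e(p)·∂_θ p = 0` and `w(p) + ∇e(p)·∂²_θ p = 0`,
  `w(p) = (∂_θ p, e''(p) ∂_θ p) = hessQuad e p (∂_θ p)`; `inner_eq_zero_of_norm_eq_const`: `∂_θ p ⊥ ∂²_θ p`
  at constant speed.
* `levelCurvature_eq_of_finrank_eq_two`, `FermiCurveParam.levelCurvature_mul_norm_gradient`: in `d = 2`
  the tree's `levelCurvature e p` is `(t, e''(p) t)/|∇e(p)|` for a unit tangent `t`, hence Lemma 2.1's
  first display `κ |∇e| = w/|∂_θ p|² = P² w` along the angular coordinate (p.9 L1–4; unsigned, as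
  `levelCurvature` is typed).
* `inner_gradient_sub_nonpos_of_hessQuad_pos`, `inner_gradient_sub_neg_of_mem_interior`,
  `HypA3.inner_gradient_sub_nonpos`: the ORIENTATION of (A3) — under the local curvature half `HypA3`
  (`(v, e''v) > 0` on tangent vectors, the orientation "`e < 0` inside `S`" of (frene), p.8 L125–126)
  and `S ∩ F = ∂C`, `∇e` is the OUTWARD normal of the convex body `C` at every point of `S ∩ F`
  (`⟨∇e(x), y - x⟩ ≤ 0` for `y ∈ C`, `< 0` for interior `y`), in `d = 2`, WITHOUT the filling condition
  (A5): a supporting functional at `x` (Hahn–Banach) is maximal along the `C²` boundary curve, so it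
  kills `γ'` and is `≤ 0` on `γ''`; in the plane it is a multiple `μ ⟨∇e(x), ·⟩`, and (Trick) with the
  curvature sign gives `μ > 0` (`exists_pos_eq_mul_inner_gradient_of_isMaxOn`).
* `exists_isAntipode_of_hessQuad_pos`, `eq_of_isAntipode_of_isAntipode`, `exists_isAntipodalMapOn`,
  `IsAntipodalMapOn.apply_apply_of_finrank_eq_two`: the
  ANTIPODE in `d = 2` (p.7 L60–66: "strict convexity implies that the equation `n(a(p)) = -n(p)` has, for
  any `p ∈ S`, a unique solution `a(p) ∈ S`") — existence (the support point of `C` in the direction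
  `-n(p)`; convexity suffices), uniqueness (strict convexity), and the antipodal map `a` of `S ∩ F` over
  which (A4) (`HypA4`) quantifies, under (A2)_{k,h} (`k ≥ 2`), (A3) (both halves), `d = 2`; again
  without (A5).
* `FermiCurveParam.norm_deriv_antipode_eq`, `FermiCurveParam.inv_norm_mul_norm_deriv_antipode_eq`:
  (curvratio) (p.9 L80–104: "`∂a/∂θ = |∂²_θ p(0,θ)|/|∂²_θ p(0,a(θ))| = κ(0,θ)/κ(0,a(θ))` — thus (A4) is
  simply a condition on the ratio of the curvatures at `p` and its antipode"), typed without an angular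
  antipode function: wherever `t ↦ a(p(0,t))` is differentiable with derivative `b` (the quantity of
  (A4) = `HypA4`), `|∂_θ p|⁻¹ |b| = antipodeAngularDeriv e a Θ θ` (the quantity of (A4′) = `HypA4'`);
  `d = 2`, (A2)_{k,h} (`k ≥ 2`), local (A3).
* `HypSy.gradient_neg`, `HypSy.unitNormal_neg`, `HypSy.isAntipodalMapOn_neg`, `HypSy.hypA4`: the
  symmetric case (Sy) (p.7 L73–77 "if (Sy) holds, `a(p) = -p`"; p.7 L86–87 "(A4) holds trivially by
  (Sy)"): `∇e` and `n` are odd, `p ↦ -p` is an antipodal map of `S ∩ F` and (A4) holds, given symmetric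
  representatives (`p ∈ S ∩ F ⇒ -p ∈ S ∩ F`); any dimension.

## How it is proved (the tree has no [I, Lemma 2.1]; no Jordan-curve theorem is used)

1. *Radial description of `∂C`.* For an interior point `c`, the gauge `g` (Minkowski functional, Mathlib
   `gauge`) of the convex bounded neighbourhood `C - c` of `0` is continuous and positive off `0`, and
   `∂C = c + {g = 1}` (`gauge_eq_one_iff_mem_frontier`); the radial map `x ↦ c + x/g(x)` sends every
   non-zero `x` to `∂C` (`gauge_inv_gauge_smul`).
2. *Transversality* (`inner_gradient_ne_zero_of_radial`, `inner_gradient_ne_zero_of_gauge`): at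
   `p = c + x₀/g(x₀)`, `⟨∇e(p), x₀⟩ ≠ 0`. If not, the implicit function theorem applied to
   `(t,s) ↦ e(c + t(x₀ + s∇e(p)))` at `(1/g(x₀), 0)` (the `s`-derivative is `‖∇e(p)‖²/g(x₀) ≠ 0`, the
   `t`-derivative is `⟨∇e(p), x₀⟩ = 0`) produces `σ` with `σ' = 0` at `1/g(x₀)` and `σ(1/g(x₀ + sv)) = s`
   for small `s`; but `1/g` is locally Lipschitz (`Convex.lipschitz_gauge`), so `|s| ≤ o(1)·|s|` — absurd.
3. *Regularity of `1/g`* (`contDiffAt_radial_of_transversal`, `contDiffAt_inv_gauge`): by 2 the implicit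
   function theorem for `(x,t) ↦ e(c + t x)` in `t` applies at `(x₀, 1/g(x₀))`; its `C^n` implicit
   function agrees with the continuous solution `1/g` near `x₀` (local uniqueness), so `1/g ∈ C^n` off
   `0` whenever `e ∈ C^n`, `n ≥ 1`.
4. *The radial curve* `γ₀(φ) = c + u(φ)/g(u(φ))`, `u(φ) = cos φ b₀ + sin φ b₁` for an orthonormal basis
   `(b₀, b₁)` (section `Circle`, `Radial`): `C¹`, `2π`-periodic, injective on `[0, 2π)`, onto `∂C`, and
   `⟨γ₀'(φ), u'(φ)⟩ = 1/g(u(φ)) > 0` (`inner_radialVelocity`), so `γ₀' ≠ 0`.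
5. *Arclength* (`exists_constSpeed_reparam`, [II] p.9 L40–66 verbatim): `S(φ) = ∫₀^φ ‖γ₀'‖` is a strictly
   increasing `C¹` bijection of `ℝ` with `S(φ + 2π) = S(φ) + ℓ`; with `P = 2π/ℓ` the curve
   `γ = γ₀ ∘ S⁻¹(·/P)` is `2π`-periodic with `‖γ'‖ = 1/P` (`HasDerivAt.of_local_left_inverse` for
   `(S⁻¹)'`).

Strict convexity enters only through convexity. The tubular coordinates `(ρ,θ) ↦ p(ρ,θ)` with
`e(p(ρ,θ)) = ρ` of [I, Lemma 2.1] (`ρ ≠ 0`) are not constructed here. No model is instantiated; nothing is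
asserted about the Kohn–Luttinger programme.
-/

noncomputable section

open Set Filter Metric
open scoped NNReal Topology

namespace Literature.MathematicalPhysics.QuantumLattice.FermiRG

section IFT

variable {X : Type*} [NormedAddCommGroup X] [NormedSpace ℝ X]

/-- For a functional `L` on `X × ℝ`, the map `t ↦ L (0, t)` is invertible as soon as
`L (0, 1) ≠ 0`. [folklore] -/
private theorem isInvertible_comp_inr (L : X × ℝ →L[ℝ] ℝ) (hL : L ((0 : X), (1 : ℝ)) ≠ 0) :
    (L ∘L ContinuousLinearMap.inr ℝ X ℝ).IsInvertible := by
  set c : ℝ := L ((0 : X), (1 : ℝ)) with hc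
  have happly : ∀ t : ℝ, (L ∘L ContinuousLinearMap.inr ℝ X ℝ) t = t * c := by
    intro t
    rw [ContinuousLinearMap.comp_apply, ContinuousLinearMap.inr_apply]
    have : ((0 : X), t) = t • ((0 : X), (1 : ℝ)) := by ext <;> simp
    rw [this, map_smul, smul_eq_mul]
  refine ContinuousLinearMap.IsInvertible.of_inverse (g := c⁻¹ • ContinuousLinearMap.id ℝ ℝ)
    ?_ ?_
  · ext
    simp [happly, hL]
  · ext
    simp [happly, hL]

end IFT

variable {E : Type*} [NormedAddCommGroup E] [InnerProductSpace ℝ E] [CompleteSpace E]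

omit [CompleteSpace E] in
/-- The affine-bilinear map `(x, t) ↦ c + t • x` has derivative `(ξ, τ) ↦ t • ξ + τ • x`. [folklore] -/
private theorem hasFDerivAt_radialMap (c : E) (u : E × ℝ) :
    HasFDerivAt (fun q : E × ℝ => c + q.2 • q.1)
      (u.2 • ContinuousLinearMap.fst ℝ E ℝ + (ContinuousLinearMap.snd ℝ E ℝ).smulRight u.1) u := by
  have h : HasFDerivAt (fun q : E × ℝ => q.2 • q.1)
      (u.2 • ContinuousLinearMap.fst ℝ E ℝ + (ContinuousLinearMap.snd ℝ E ℝ).smulRight u.1) u :=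
    HasFDerivAt.smul hasFDerivAt_snd hasFDerivAt_fst
  exact h.const_add c

/-- **Radial implicit-function transfer.** If `e` is `C^n` (`n ≥ 1`) at `p = c + h x₀ • x₀`, the ray
direction is transversal there (`⟨∇e p, x₀⟩ ≠ 0`), `h` is continuous at `x₀` and `e (c + h y • y) = 0`
for `y` near `x₀`, then `h` is `C^n` at `x₀`: it coincides near `x₀` with the implicit function of
`(x, t) ↦ e (c + t • x)`. [folklore] -/
private theorem contDiffAt_radial_of_transversal {n : WithTop ℕ∞} {e : E → ℝ} {c x₀ : E} {h : E → ℝ}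
    (hn : 1 ≤ n) (he : ContDiffAt ℝ n e (c + h x₀ • x₀))
    (htrans : inner ℝ (gradient e (c + h x₀ • x₀)) x₀ ≠ 0) (hcont : ContinuousAt h x₀)
    (hzero : ∀ᶠ y in 𝓝 x₀, e (c + h y • y) = 0) : ContDiffAt ℝ n h x₀ := by
  have hn0 : n ≠ 0 := by
    intro h0; rw [h0] at hn; exact absurd hn (by simp)
  set u : E × ℝ := (x₀, h x₀) with hu
  set F : E × ℝ → ℝ := fun q => e (c + q.2 • q.1) with hF
  have hA : HasFDerivAt (fun q : E × ℝ => c + q.2 • q.1)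
      (u.2 • ContinuousLinearMap.fst ℝ E ℝ + (ContinuousLinearMap.snd ℝ E ℝ).smulRight u.1) u :=
    hasFDerivAt_radialMap c u
  have hcd : ContDiffAt ℝ n F u := by
    have hsm : ContDiff ℝ n (fun q : E × ℝ => c + q.2 • q.1) :=
      contDiff_const.add (contDiff_snd.smul contDiff_fst)
    exact ContDiffAt.comp u he hsm.contDiffAt
  have hed : DifferentiableAt ℝ e (c + h x₀ • x₀) := he.differentiableAt hn0
  have hFd : HasFDerivAt F ((fderiv ℝ e (c + h x₀ • x₀)).comp
      (u.2 • ContinuousLinearMap.fst ℝ E ℝ + (ContinuousLinearMap.snd ℝ E ℝ).smulRight u.1)) u :=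
    hed.hasFDerivAt.comp u hA
  have hT : fderiv ℝ F u ((0 : E), (1 : ℝ)) ≠ 0 := by
    rw [hFd.fderiv]
    simpa [← inner_gradient_left] using htrans
  have hinv := isInvertible_comp_inr (fderiv ℝ F u) hT
  set χ : E → ℝ := hcd.implicitFunction hn0 hinv with hχ
  have hχu : χ x₀ = h x₀ := hcd.implicitFunction_apply_self hn0 hinv
  have hχC : ContDiffAt ℝ n χ x₀ := hcd.contDiffAt_implicitFunction hn0 hinv
  have hχeq : ∀ᶠ q in 𝓝 u, F q = F u ↔ χ q.1 = q.2 :=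
    hcd.eventually_apply_eq_iff_implicitFunction hn0 hinv
  have hFu : F u = 0 := by
    have := hzero.self_of_nhds
    simpa [hF] using this
  have hcurve : Tendsto (fun y : E => (y, h y)) (𝓝 x₀) (𝓝 u) :=
    (continuous_id.tendsto x₀).prodMk_nhds hcont
  have hEq : ∀ᶠ y in 𝓝 x₀, χ y = h y := by
    filter_upwards [hcurve.eventually hχeq, hzero] with y hy hz
    have hFy : F (y, h y) = F u := by rw [hFu]; simpa [hF] using hz
    exact hy.1 hFy
  exact hχC.congr_of_eventuallyEq (hEq.mono fun y hy => hy.symm)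

/-- **Rays from the centre are transversal to the level curve.** Let `h` be continuous and locally
Lipschitz at `x₀` with `h x₀ ≠ 0`, suppose `e (c + h y • y) = 0` for all `y` near `x₀`, and let `e` be
`C¹` near `p = c + h x₀ • x₀` with `∇e p ≠ 0`. Then `⟨∇e p, x₀⟩ ≠ 0`. (Otherwise the implicit function
theorem for `(t, s) ↦ e (c + t • (x₀ + s • ∇e p))` gives `s = σ (h (x₀ + s • ∇e p))` near `s = 0`
with `σ' (h x₀) = 0`, which contradicts the Lipschitz bound on `h`.) [folklore] -/
private theorem inner_gradient_ne_zero_of_radial {e : E → ℝ} {c x₀ : E} {h : E → ℝ}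
    (he : ContDiffAt ℝ 1 e (c + h x₀ • x₀)) (hgrad : gradient e (c + h x₀ • x₀) ≠ 0)
    (hh0 : h x₀ ≠ 0) (hcont : ContinuousAt h x₀)
    (hlip : ∃ K : ℝ, ∀ᶠ y in 𝓝 x₀, |h y - h x₀| ≤ K * ‖y - x₀‖)
    (hzero : ∀ᶠ y in 𝓝 x₀, e (c + h y • y) = 0) :
    inner ℝ (gradient e (c + h x₀ • x₀)) x₀ ≠ 0 := by
  intro hinner
  obtain ⟨K, hK⟩ := hlip
  set p : E := c + h x₀ • x₀ with hp
  set v : E := gradient e p with hv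
  set t₀ : ℝ := h x₀ with ht₀
  set G : ℝ × ℝ → ℝ := fun q => e (c + q.1 • (x₀ + q.2 • v)) with hG
  set u : ℝ × ℝ := (t₀, 0) with hu
  have hBu : c + u.1 • (x₀ + u.2 • v) = p := by simp [hu, hp, ht₀]
  have hB : HasFDerivAt (fun q : ℝ × ℝ => c + q.1 • (x₀ + q.2 • v))
      (u.1 • ((ContinuousLinearMap.snd ℝ ℝ ℝ).smulRight v) +
        (ContinuousLinearMap.fst ℝ ℝ ℝ).smulRight (x₀ + u.2 • v)) u := by
    have h2 : HasFDerivAt (fun q : ℝ × ℝ => x₀ + q.2 • v)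
        ((ContinuousLinearMap.snd ℝ ℝ ℝ).smulRight v) u :=
      (hasFDerivAt_snd.smul_const v).const_add x₀
    have h1 : HasFDerivAt (fun q : ℝ × ℝ => q.1 • (x₀ + q.2 • v))
        (u.1 • ((ContinuousLinearMap.snd ℝ ℝ ℝ).smulRight v) +
          (ContinuousLinearMap.fst ℝ ℝ ℝ).smulRight (x₀ + u.2 • v)) u :=
      HasFDerivAt.smul hasFDerivAt_fst h2
    exact h1.const_add c
  have hed : DifferentiableAt ℝ e p := he.differentiableAt one_ne_zero
  have hGd : HasFDerivAt G ((fderiv ℝ e p).comp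
      (u.1 • ((ContinuousLinearMap.snd ℝ ℝ ℝ).smulRight v) +
        (ContinuousLinearMap.fst ℝ ℝ ℝ).smulRight (x₀ + u.2 • v))) u := by
    have h1 : HasFDerivAt e (fderiv ℝ e p) (c + u.1 • (x₀ + u.2 • v)) := by
      rw [hBu]; exact hed.hasFDerivAt
    exact h1.comp u hB
  have hvne : ‖v‖ ≠ 0 := norm_ne_zero_iff.2 hgrad
  have hG01 : fderiv ℝ G u ((0 : ℝ), (1 : ℝ)) = t₀ * ‖v‖ ^ 2 := by
    rw [hGd.fderiv]
    simp [hu, ← inner_gradient_left, ← hv]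
  have hG10 : fderiv ℝ G u ((1 : ℝ), (0 : ℝ)) = 0 := by
    rw [hGd.fderiv]
    simpa [hu, ← inner_gradient_left, ← hv] using hinner
  have hT : fderiv ℝ G u ((0 : ℝ), (1 : ℝ)) ≠ 0 := by
    rw [hG01]; exact mul_ne_zero hh0 (pow_ne_zero 2 hvne)
  have hcd : ContDiffAt ℝ 1 G u := by
    have hsm : ContDiff ℝ 1 (fun q : ℝ × ℝ => c + q.1 • (x₀ + q.2 • v)) :=
      contDiff_const.add (contDiff_fst.smul (contDiff_const.add (contDiff_snd.smul contDiff_const)))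
    have he' : ContDiffAt ℝ 1 e (c + u.1 • (x₀ + u.2 • v)) := by rw [hBu]; exact he
    exact he'.comp u hsm.contDiffAt
  have hinv := isInvertible_comp_inr (fderiv ℝ G u) hT
  set σ : ℝ → ℝ := hcd.implicitFunction one_ne_zero hinv with hσ
  have hσu : σ t₀ = 0 := hcd.implicitFunction_apply_self one_ne_zero hinv
  have hσC : ContDiffAt ℝ 1 σ t₀ := hcd.contDiffAt_implicitFunction one_ne_zero hinv
  have hσeq : ∀ᶠ q in 𝓝 u, G q = G u ↔ σ q.1 = q.2 :=
    hcd.eventually_apply_eq_iff_implicitFunction one_ne_zero hinv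
  have hGu : G u = 0 := by
    have h0 : e (c + h x₀ • x₀) = 0 := hzero.self_of_nhds
    show e (c + u.1 • (x₀ + u.2 • v)) = 0
    rw [hBu]; exact h0
  -- `G (t, σ t) = 0` near `t₀`, hence `σ' (t₀) = 0`
  have hσcurve : Tendsto (fun t : ℝ => (t, σ t)) (𝓝 t₀) (𝓝 u) := by
    have : u = (t₀, σ t₀) := by rw [hσu]
    rw [this]
    exact (continuous_id.tendsto t₀).prodMk_nhds hσC.continuousAt
  have hGσ : ∀ᶠ t in 𝓝 t₀, G (t, σ t) = 0 := by
    filter_upwards [hσcurve.eventually hσeq] with t ht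
    rw [← hGu]; exact ht.2 rfl
  have hσd : HasDerivAt σ (deriv σ t₀) t₀ := (hσC.differentiableAt one_ne_zero).hasDerivAt
  have hcomp : HasDerivAt (fun t : ℝ => G (t, σ t)) (fderiv ℝ G u ((1 : ℝ), deriv σ t₀)) t₀ := by
    have hGd' : HasFDerivAt G (fderiv ℝ G u) (t₀, σ t₀) := by
      rw [hσu]; exact hGd.differentiableAt.hasFDerivAt
    have hpair : HasDerivAt (fun t : ℝ => (t, σ t)) ((1 : ℝ), deriv σ t₀) t₀ :=
      (hasDerivAt_id t₀).prodMk hσd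
    exact hGd'.comp_hasDerivAt t₀ hpair
  have hzero' : HasDerivAt (fun t : ℝ => G (t, σ t)) 0 t₀ :=
    (hasDerivAt_const t₀ (0 : ℝ)).congr_of_eventuallyEq hGσ
  have hderiv0 : deriv σ t₀ = 0 := by
    have hlin := hcomp.unique hzero'
    have hsplit : ((1 : ℝ), deriv σ t₀) = ((1 : ℝ), (0 : ℝ)) + (deriv σ t₀) • ((0 : ℝ), (1 : ℝ)) := by
      ext <;> simp
    rw [hsplit, map_add, map_smul, hG10, hG01, smul_eq_mul, zero_add] at hlin
    rcases mul_eq_zero.1 hlin with h0 | h0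
    · exact h0
    · exact absurd h0 (mul_ne_zero hh0 (pow_ne_zero 2 hvne))
  have hσ0 : HasDerivAt σ 0 t₀ := hderiv0 ▸ hσd
  -- along the boundary curve `s ↦ x₀ + s • v` we have `σ (h (x₀ + s • v)) = s`
  have hy : Tendsto (fun s : ℝ => x₀ + s • v) (𝓝 0) (𝓝 x₀) := by
    have : Continuous (fun s : ℝ => x₀ + s • v) := by fun_prop
    simpa using this.tendsto 0
  have hhy : Tendsto (fun s : ℝ => h (x₀ + s • v)) (𝓝 0) (𝓝 t₀) := hcont.tendsto.comp hy
  have hys : Tendsto (fun s : ℝ => (h (x₀ + s • v), s)) (𝓝 0) (𝓝 u) :=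
    hhy.prodMk_nhds (continuous_id.tendsto 0)
  have hσid : ∀ᶠ s in 𝓝 (0 : ℝ), σ (h (x₀ + s • v)) = s := by
    filter_upwards [hys.eventually hσeq, hy.eventually hzero] with s hs hz
    apply hs.1
    rw [hGu]
    exact hz
  -- the Lipschitz bound along the curve
  set K' : ℝ := max K 1 with hK'
  have hK'pos : 0 < K' := lt_of_lt_of_le one_pos (le_max_right _ _)
  have hlipK' : ∀ᶠ s in 𝓝 (0 : ℝ), |h (x₀ + s • v) - t₀| ≤ K' * ‖v‖ * |s| := by
    filter_upwards [hy.eventually hK] with s hs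
    calc |h (x₀ + s • v) - t₀| ≤ K * ‖x₀ + s • v - x₀‖ := hs
      _ = K * (‖v‖ * |s|) := by rw [add_sub_cancel_left, norm_smul, Real.norm_eq_abs, mul_comm |s|]
      _ ≤ K' * (‖v‖ * |s|) := by gcongr; exact le_max_left _ _
      _ = K' * ‖v‖ * |s| := by ring
  -- the little-o bound from `σ' (t₀) = 0`
  have hKv : 0 < K' * ‖v‖ := mul_pos hK'pos (norm_pos_iff.2 hgrad)
  set ε : ℝ := 1 / (2 * (K' * ‖v‖)) with hε
  have hεpos : 0 < ε := by positivity
  have hsmall : ∀ᶠ t in 𝓝 t₀, |σ t - σ t₀| ≤ ε * |t - t₀| := by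
    have h2 := (hasDerivAt_iff_isLittleO.1 hσ0).def hεpos
    filter_upwards [h2] with t ht
    simpa [Real.norm_eq_abs] using ht
  have hsmall' : ∀ᶠ s in 𝓝 (0 : ℝ), |σ (h (x₀ + s • v)) - σ t₀| ≤ ε * |h (x₀ + s • v) - t₀| :=
    hhy.eventually hsmall
  have hfinal : ∀ᶠ s in 𝓝 (0 : ℝ), |s| ≤ |s| / 2 := by
    filter_upwards [hσid, hlipK', hsmall'] with s h1 h2 h3
    rw [h1, hσu, sub_zero] at h3
    calc |s| ≤ ε * |h (x₀ + s • v) - t₀| := h3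
      _ ≤ ε * (K' * ‖v‖ * |s|) := by gcongr
      _ = |s| / 2 := by rw [hε]; field_simp
  obtain ⟨δ, hδ, hball⟩ := Metric.eventually_nhds_iff.1 hfinal
  have hmem : dist (δ / 2) (0 : ℝ) < δ := by
    rw [dist_zero_right, Real.norm_eq_abs, abs_of_pos (by positivity)]; linarith
  have h1 := hball hmem
  have hδ2 : (0 : ℝ) < |δ / 2| := abs_pos.2 (by positivity)
  linarith

/-! ### The radial function `ρ = 1 / gauge` of a convex body around an interior point -/

section Gauge

variable {s : Set E}

omit [CompleteSpace E] in
/-- The radial point `x / g(x)` of a non-zero `x` has gauge `1`. [folklore] -/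
private theorem gauge_inv_gauge_smul (hs0 : s ∈ 𝓝 (0 : E)) (hsb : Bornology.IsVonNBounded ℝ s) {x : E}
    (hx : x ≠ 0) : gauge s ((gauge s x)⁻¹ • x) = 1 := by
  have hpos : 0 < gauge s x := (gauge_pos (absorbent_nhds_zero hs0) hsb).2 hx
  rw [gauge_smul_of_nonneg (inv_nonneg.2 hpos.le), smul_eq_mul, inv_mul_cancel₀ hpos.ne']

omit [CompleteSpace E] in
/-- `1 / gauge` is continuous away from the origin. [folklore] -/
private theorem continuousAt_inv_gauge (hsc : Convex ℝ s) (hs0 : s ∈ 𝓝 (0 : E))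
    (hsb : Bornology.IsVonNBounded ℝ s) {x₀ : E} (hx₀ : x₀ ≠ 0) :
    ContinuousAt (fun y => (gauge s y)⁻¹) x₀ :=
  (continuous_gauge hsc hs0).continuousAt.inv₀
    ((gauge_pos (absorbent_nhds_zero hs0) hsb).2 hx₀).ne'

omit [CompleteSpace E] in
/-- `1 / gauge` is locally Lipschitz away from the origin (the gauge of a convex neighbourhood of `0`
is Lipschitz, `Convex.lipschitz_gauge`). [folklore] -/
private theorem exists_lipschitz_inv_gauge (hsc : Convex ℝ s) (hs0 : s ∈ 𝓝 (0 : E))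
    (hsb : Bornology.IsVonNBounded ℝ s) {x₀ : E} (hx₀ : x₀ ≠ 0) :
    ∃ K : ℝ, ∀ᶠ y in 𝓝 x₀, |(gauge s y)⁻¹ - (gauge s x₀)⁻¹| ≤ K * ‖y - x₀‖ := by
  obtain ⟨L, hL⟩ := hsc.lipschitz_gauge hs0
  have hpos : 0 < gauge s x₀ := (gauge_pos (absorbent_nhds_zero hs0) hsb).2 hx₀
  set m : ℝ := gauge s x₀ / 2 with hm
  have hmpos : 0 < m := by positivity
  have hge : ∀ᶠ y in 𝓝 x₀, m ≤ gauge s y :=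
    ((continuous_gauge hsc hs0).tendsto x₀).eventually_const_le (by rw [hm]; linarith)
  refine ⟨(L : ℝ) / (m * gauge s x₀), ?_⟩
  filter_upwards [hge] with y hy
  have hypos : 0 < gauge s y := lt_of_lt_of_le hmpos hy
  rw [inv_sub_inv hypos.ne' hpos.ne', abs_div, abs_of_pos (mul_pos hypos hpos),
    div_le_iff₀ (mul_pos hypos hpos)]
  have hdist : |gauge s x₀ - gauge s y| ≤ L * ‖y - x₀‖ := by
    rw [abs_sub_comm, ← Real.dist_eq, ← dist_eq_norm]; exact hL.dist_le_mul y x₀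
  calc |gauge s x₀ - gauge s y| ≤ L * ‖y - x₀‖ := hdist
    _ = (L : ℝ) / (m * gauge s x₀) * ‖y - x₀‖ * (m * gauge s x₀) := by
        field_simp
    _ ≤ (L : ℝ) / (m * gauge s x₀) * ‖y - x₀‖ * (gauge s y * gauge s x₀) := by
        gcongr

/-- **The ray through any non-zero `x₀` crosses the frontier transversally** when the frontier of
the body `s` (the set `gauge = 1`, translated by `c`) consists of regular zeros of a `C¹` function
`e`: `⟨∇e (c + x₀ / g(x₀)), x₀⟩ ≠ 0` — the radial-chart form of [II] p.7 L60–62 ("`S` bounds a strictly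
convex set … in two dimensions, `S` is a simple closed curve": no tangent line of `S = ∂C` passes through
an interior point). [cite: FeldmanSalmhoferTrubowitz1998, Assumption A3 (arXiv p.7 L60–62)] -/
theorem inner_gradient_ne_zero_of_gauge (hsc : Convex ℝ s) (hs0 : s ∈ 𝓝 (0 : E))
    (hsb : Bornology.IsVonNBounded ℝ s) {e : E → ℝ} {c : E} (he : ContDiff ℝ 1 e)
    (hzero : ∀ x, gauge s x = 1 → e (c + x) = 0)
    (hgrad : ∀ x, gauge s x = 1 → gradient e (c + x) ≠ 0) {x₀ : E} (hx₀ : x₀ ≠ 0) :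
    inner ℝ (gradient e (c + (gauge s x₀)⁻¹ • x₀)) x₀ ≠ 0 := by
  have hpos : 0 < gauge s x₀ := (gauge_pos (absorbent_nhds_zero hs0) hsb).2 hx₀
  refine inner_gradient_ne_zero_of_radial (h := fun y => (gauge s y)⁻¹) he.contDiffAt
    (hgrad _ (gauge_inv_gauge_smul hs0 hsb hx₀)) (inv_ne_zero hpos.ne')
    (continuousAt_inv_gauge hsc hs0 hsb hx₀) (exists_lipschitz_inv_gauge hsc hs0 hsb hx₀) ?_
  filter_upwards [eventually_ne_nhds hx₀] with y hy
  exact hzero _ (gauge_inv_gauge_smul hs0 hsb hy)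

/-- **The radial function `1 / gauge` is `C^n` away from the origin** when the frontier of the body
consists of regular zeros of a `C^n` function (`n ≥ 1`) — the radial-chart form of [II] p.7 L55 with
p.7 L60–62 ("Assumption (A2) implies that `S` is a `C^k` submanifold of `𝓑`"; "`S` bounds a strictly
convex set"): `S = ∂C` is the `C^k` radial graph `x ↦ c + x / g(x)` over the directions at an interior
point `c`. [cite: FeldmanSalmhoferTrubowitz1998, Assumption A2–A3 (arXiv p.7 L55, L60–62)] -/
theorem contDiffAt_inv_gauge (hsc : Convex ℝ s) (hs0 : s ∈ 𝓝 (0 : E))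
    (hsb : Bornology.IsVonNBounded ℝ s) {n : WithTop ℕ∞} {e : E → ℝ} {c : E} (hn : 1 ≤ n)
    (he : ContDiff ℝ n e) (hzero : ∀ x, gauge s x = 1 → e (c + x) = 0)
    (hgrad : ∀ x, gauge s x = 1 → gradient e (c + x) ≠ 0) {x₀ : E} (hx₀ : x₀ ≠ 0) :
    ContDiffAt ℝ n (fun y => (gauge s y)⁻¹) x₀ := by
  refine contDiffAt_radial_of_transversal hn he.contDiffAt
    (inner_gradient_ne_zero_of_gauge hsc hs0 hsb (he.of_le hn) hzero hgrad hx₀)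
    (continuousAt_inv_gauge hsc hs0 hsb hx₀) ?_
  filter_upwards [eventually_ne_nhds hx₀] with y hy
  exact hzero _ (gauge_inv_gauge_smul hs0 hsb hy)

end Gauge

/-! ### The unit circle of a two-dimensional inner-product space -/

section Circle

variable (b : OrthonormalBasis (Fin 2) ℝ E)

omit [CompleteSpace E] in
/-- Inner products in an orthonormal basis of a plane. [folklore] -/
private theorem inner_circleComb (a₁ a₂ a₁' a₂' : ℝ) :
    inner ℝ (a₁ • b 0 + a₂ • b 1) (a₁' • b 0 + a₂' • b 1) = a₁ * a₁' + a₂ * a₂' := by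
  have h01 : inner ℝ (b 0) (b 1) = 0 := b.inner_eq_zero (by decide)
  have h10 : inner ℝ (b 1) (b 0) = 0 := b.inner_eq_zero (by decide)
  simp only [inner_add_left, inner_add_right, real_inner_smul_left, real_inner_smul_right,
    b.inner_eq_one, h01, h10]
  ring

omit [CompleteSpace E] in
/-- Coordinates in an orthonormal basis of a plane. [folklore] -/
private theorem inner_basis_circleComb (a₁ a₂ : ℝ) :
    inner ℝ (b 0) (a₁ • b 0 + a₂ • b 1) = a₁ ∧ inner ℝ (b 1) (a₁ • b 0 + a₂ • b 1) = a₂ := by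
  have h1 := inner_circleComb b 1 0 a₁ a₂
  have h2 := inner_circleComb b 0 1 a₁ a₂
  simp only [one_smul, zero_smul, add_zero, zero_add, one_mul, zero_mul] at h1 h2
  exact ⟨h1, h2⟩

omit [CompleteSpace E] in
/-- Points of the unit circle have norm one. [folklore] -/
private theorem norm_circleMap_basis (φ : ℝ) : ‖Real.cos φ • b 0 + Real.sin φ • b 1‖ = 1 := by
  have h := inner_circleComb b (Real.cos φ) (Real.sin φ) (Real.cos φ) (Real.sin φ)
  rw [real_inner_self_eq_norm_sq] at h
  have h1 : ‖Real.cos φ • b 0 + Real.sin φ • b 1‖ ^ 2 = 1 := by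
    rw [h]; nlinarith [Real.cos_sq_add_sin_sq φ]
  have hnn := norm_nonneg (Real.cos φ • b 0 + Real.sin φ • b 1)
  nlinarith

omit [CompleteSpace E] in
/-- Every unit vector of the plane is on the parametrised circle. [folklore] -/
private theorem exists_circleMap_basis_eq {w : E} (hw : ‖w‖ = 1) :
    ∃ φ : ℝ, Real.cos φ • b 0 + Real.sin φ • b 1 = w := by
  set a₁ : ℝ := inner ℝ (b 0) w with ha₁
  set a₂ : ℝ := inner ℝ (b 1) w with ha₂
  have hw' : a₁ • b 0 + a₂ • b 1 = w := by
    have := b.sum_repr' w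
    simpa [Fin.sum_univ_two] using this
  have hsq : a₁ ^ 2 + a₂ ^ 2 = 1 := by
    have h := inner_circleComb b a₁ a₂ a₁ a₂
    rw [hw', real_inner_self_eq_norm_sq, hw] at h
    nlinarith
  set z : ℂ := ⟨a₁, a₂⟩ with hz
  have hnorm : ‖z‖ = 1 := by
    rw [Complex.norm_def, Complex.normSq_mk]
    rw [show a₁ * a₁ + a₂ * a₂ = 1 by nlinarith, Real.sqrt_one]
  have hz0 : z ≠ 0 := by
    intro h0; rw [h0, norm_zero] at hnorm; exact zero_ne_one hnorm
  refine ⟨Complex.arg z, ?_⟩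
  rw [Complex.cos_arg hz0, Complex.sin_arg, hnorm, div_one, div_one]
  exact hw'

omit [CompleteSpace E] in
/-- The parametrised circle is injective on a period. [folklore] -/
private theorem eq_of_circleMap_basis_eq {φ₁ φ₂ : ℝ} (hφ₁ : φ₁ ∈ Ico 0 (2 * Real.pi))
    (hφ₂ : φ₂ ∈ Ico 0 (2 * Real.pi))
    (h : Real.cos φ₁ • b 0 + Real.sin φ₁ • b 1 = Real.cos φ₂ • b 0 + Real.sin φ₂ • b 1) :
    φ₁ = φ₂ := by
  have hc : Real.cos φ₁ = Real.cos φ₂ := by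
    have h1 := (inner_basis_circleComb b (Real.cos φ₁) (Real.sin φ₁)).1
    rw [h, (inner_basis_circleComb b (Real.cos φ₂) (Real.sin φ₂)).1] at h1
    exact h1.symm
  have hs : Real.sin φ₁ = Real.sin φ₂ := by
    have h1 := (inner_basis_circleComb b (Real.cos φ₁) (Real.sin φ₁)).2
    rw [h, (inner_basis_circleComb b (Real.cos φ₂) (Real.sin φ₂)).2] at h1
    exact h1.symm
  have hcos1 : Real.cos (φ₁ - φ₂) = 1 := by
    rw [Real.cos_sub, hc, hs]
    nlinarith [Real.cos_sq_add_sin_sq φ₂]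
  obtain ⟨n, hn⟩ := (Real.cos_eq_one_iff (φ₁ - φ₂)).1 hcos1
  have hlt : |φ₁ - φ₂| < 2 * Real.pi := by
    rw [abs_lt]; constructor <;> linarith [hφ₁.1, hφ₁.2, hφ₂.1, hφ₂.2]
  rw [← hn, abs_lt] at hlt
  have hn1 : (n : ℝ) < 1 := by
    by_contra hle; push Not at hle
    have : (1 : ℝ) * (2 * Real.pi) ≤ n * (2 * Real.pi) := by gcongr
    linarith [hlt.2]
  have hn2 : (-1 : ℝ) < n := by
    by_contra hle; push Not at hle
    have : (n : ℝ) * (2 * Real.pi) ≤ (-1) * (2 * Real.pi) :=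
      mul_le_mul_of_nonneg_right hle (by positivity)
    linarith [hlt.1]
  have hn0 : n = 0 := by
    have h1 : n < 1 := by exact_mod_cast hn1
    have h2 : -1 < n := by exact_mod_cast hn2
    omega
  rw [hn0] at hn; simp at hn; linarith

omit [CompleteSpace E] in
/-- The velocity of the parametrised circle. [folklore] -/
private theorem hasDerivAt_circleMap_basis (φ : ℝ) :
    HasDerivAt (fun θ => Real.cos θ • b 0 + Real.sin θ • b 1)
      (-Real.sin φ • b 0 + Real.cos φ • b 1) φ :=
  ((Real.hasDerivAt_cos φ).smul_const (b 0)).add ((Real.hasDerivAt_sin φ).smul_const (b 1))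

omit [CompleteSpace E] in
/-- The parametrised circle is smooth. [folklore] -/
private theorem contDiff_circleMap_basis {n : WithTop ℕ∞} :
    ContDiff ℝ n (fun θ => Real.cos θ • b 0 + Real.sin θ • b 1) :=
  (Real.contDiff_cos.smul contDiff_const).add (Real.contDiff_sin.smul contDiff_const)

end Circle

/-! ### The radial parametrisation `φ ↦ c + u(φ) / g(u(φ))` of the frontier of a planar convex body -/

section Radial

variable {s : Set E} (b : OrthonormalBasis (Fin 2) ℝ E)

omit [CompleteSpace E] in
/-- The radial parametrisation `φ ↦ u(φ) / g(u(φ))` over the unit circle `u` lands on the frontier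
`{gauge = 1}` ([II] p.7 L60–62: "in two dimensions, `S` is a simple closed curve" — with the next two
lemmas: `∂C` is the injective radial image of one period of the circle).
[cite: FeldmanSalmhoferTrubowitz1998, Assumption A3 (arXiv p.7 L60–62)] -/
theorem gauge_radialParam (hs0 : s ∈ 𝓝 (0 : E)) (hsb : Bornology.IsVonNBounded ℝ s) (φ : ℝ) :
    gauge s ((gauge s (Real.cos φ • b 0 + Real.sin φ • b 1))⁻¹ •
      (Real.cos φ • b 0 + Real.sin φ • b 1)) = 1 := by
  apply gauge_inv_gauge_smul hs0 hsb
  intro h0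
  have := norm_circleMap_basis b φ
  rw [h0, norm_zero] at this
  exact zero_ne_one this

omit [CompleteSpace E] in
/-- The radial parametrisation covers the frontier `{gauge = 1}` within one period `[0, 2π)` ([II]
p.7 L60–62: "`S` is a simple closed curve"). [cite: FeldmanSalmhoferTrubowitz1998, Assumption A3 (arXiv p.7 L60–62)] -/
theorem exists_radialParam_eq {x : E} (hx : gauge s x = 1) :
    ∃ φ ∈ Ico 0 (2 * Real.pi), (gauge s (Real.cos φ • b 0 + Real.sin φ • b 1))⁻¹ •
      (Real.cos φ • b 0 + Real.sin φ • b 1) = x := by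
  have hx0 : x ≠ 0 := by
    intro h0; rw [h0, gauge_zero] at hx; exact zero_ne_one hx
  have hnx : 0 < ‖x‖ := norm_pos_iff.2 hx0
  obtain ⟨φ₀, hφ₀⟩ := exists_circleMap_basis_eq b (w := ‖x‖⁻¹ • x)
    (by rw [norm_smul, norm_inv, norm_norm, inv_mul_cancel₀ hnx.ne'])
  -- reduce `φ₀` to the fundamental period
  have hper : Function.Periodic (fun φ : ℝ => Real.cos φ • b 0 + Real.sin φ • b 1) (2 * Real.pi) := by
    intro φ; simp [Real.cos_add_two_pi, Real.sin_add_two_pi]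
  obtain ⟨φ, hφ, hφeq⟩ := hper.exists_mem_Ico₀ Real.two_pi_pos φ₀
  refine ⟨φ, hφ, ?_⟩
  have hu : Real.cos φ • b 0 + Real.sin φ • b 1 = ‖x‖⁻¹ • x := by
    rw [← hφeq]; exact hφ₀
  rw [hu, gauge_smul_of_nonneg (inv_nonneg.2 hnx.le), hx, smul_eq_mul, mul_one, inv_inv, smul_smul,
    mul_inv_cancel₀ hnx.ne', one_smul]

omit [CompleteSpace E] in
/-- The radial parametrisation is injective on one period `[0, 2π)` ([II] p.7 L60–62: "`S` is a simple
closed curve"). [cite: FeldmanSalmhoferTrubowitz1998, Assumption A3 (arXiv p.7 L60–62)] -/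
theorem injOn_radialParam (hs0 : s ∈ 𝓝 (0 : E)) (hsb : Bornology.IsVonNBounded ℝ s) :
    InjOn (fun φ : ℝ => (gauge s (Real.cos φ • b 0 + Real.sin φ • b 1))⁻¹ •
      (Real.cos φ • b 0 + Real.sin φ • b 1)) (Ico 0 (2 * Real.pi)) := by
  intro φ₁ hφ₁ φ₂ hφ₂ h
  simp only at h
  set u₁ : E := Real.cos φ₁ • b 0 + Real.sin φ₁ • b 1 with hu₁
  set u₂ : E := Real.cos φ₂ • b 0 + Real.sin φ₂ • b 1 with hu₂
  have hn₁ : ‖u₁‖ = 1 := norm_circleMap_basis b φ₁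
  have hn₂ : ‖u₂‖ = 1 := norm_circleMap_basis b φ₂
  have hne₁ : u₁ ≠ 0 := by intro h0; rw [h0, norm_zero] at hn₁; exact zero_ne_one hn₁
  have hne₂ : u₂ ≠ 0 := by intro h0; rw [h0, norm_zero] at hn₂; exact zero_ne_one hn₂
  have hp₁ : 0 < gauge s u₁ := (gauge_pos (absorbent_nhds_zero hs0) hsb).2 hne₁
  have hp₂ : 0 < gauge s u₂ := (gauge_pos (absorbent_nhds_zero hs0) hsb).2 hne₂
  -- taking norms: the radii agree
  have hr : (gauge s u₁)⁻¹ = (gauge s u₂)⁻¹ := by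
    have := congrArg (fun z : E => ‖z‖) h
    simp only [norm_smul, norm_inv, Real.norm_eq_abs, abs_of_pos hp₁, abs_of_pos hp₂, hn₁, hn₂,
      mul_one] at this
    exact this
  rw [hr] at h
  have hu : u₁ = u₂ := smul_right_injective E (inv_ne_zero hp₂.ne') h
  exact eq_of_circleMap_basis_eq b hφ₁ hφ₂ hu

omit [CompleteSpace E] in
/-- Velocity of a radial curve `θ ↦ c + ρ(u θ) • u θ`. [folklore] -/
private theorem hasDerivAt_radialCurve {ρ : E → ℝ} {ρ' : E →L[ℝ] ℝ} {u : ℝ → E} {u' : E} {φ : ℝ} (c : E)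
    (hu : HasDerivAt u u' φ) (hρ : HasFDerivAt ρ ρ' (u φ)) :
    HasDerivAt (fun θ => c + ρ (u θ) • u θ) (ρ (u φ) • u' + (ρ' u') • u φ) φ := by
  have h1 : HasDerivAt (fun θ => ρ (u θ)) (ρ' u') φ := hρ.comp_hasDerivAt φ hu
  exact (h1.smul hu).const_add c

omit [CompleteSpace E] in
/-- The velocity of the radial curve has component `ρ(u φ)` along the (unit, orthogonal) velocity of
the circle, hence does not vanish when `ρ > 0`. [folklore] -/
private theorem inner_radialVelocity (ρ₀ a : ℝ) (φ : ℝ) :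
    inner ℝ (ρ₀ • (-Real.sin φ • b 0 + Real.cos φ • b 1) + a • (Real.cos φ • b 0 + Real.sin φ • b 1))
      (-Real.sin φ • b 0 + Real.cos φ • b 1) = ρ₀ := by
  rw [inner_add_left, real_inner_smul_left, real_inner_smul_left, inner_circleComb, inner_circleComb]
  linear_combination ρ₀ * Real.sin_sq_add_cos_sq φ

omit [CompleteSpace E] in
/-- A radial curve over the circle is `C¹` when the radial function is `C¹` off the origin. [folklore] -/
private theorem contDiff_radialCurve {ρ : E → ℝ} (c : E) (hρ : ∀ x : E, x ≠ 0 → ContDiffAt ℝ 1 ρ x) :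
    ContDiff ℝ 1 (fun θ : ℝ => c + ρ (Real.cos θ • b 0 + Real.sin θ • b 1) •
      (Real.cos θ • b 0 + Real.sin θ • b 1)) := by
  have hu : ContDiff ℝ 1 (fun θ : ℝ => Real.cos θ • b 0 + Real.sin θ • b 1) :=
    contDiff_circleMap_basis b
  refine contDiff_iff_contDiffAt.2 fun θ => ?_
  have hne : Real.cos θ • b 0 + Real.sin θ • b 1 ≠ 0 := by
    intro h0
    have := norm_circleMap_basis b θ
    rw [h0, norm_zero] at this
    exact zero_ne_one this
  have h1 : ContDiffAt ℝ 1 (fun θ : ℝ => ρ (Real.cos θ • b 0 + Real.sin θ • b 1)) θ :=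
    (hρ _ hne).comp θ hu.contDiffAt
  exact contDiffAt_const.add (h1.smul hu.contDiffAt)

omit [CompleteSpace E] in
/-- A radial curve over the circle is `C^n` when the radial function is `C^n` off the origin. [folklore] -/
private theorem contDiff_radialCurve_of_contDiffAt {n : WithTop ℕ∞} {ρ : E → ℝ} (c : E)
    (hρ : ∀ x : E, x ≠ 0 → ContDiffAt ℝ n ρ x) :
    ContDiff ℝ n (fun θ : ℝ => c + ρ (Real.cos θ • b 0 + Real.sin θ • b 1) •
      (Real.cos θ • b 0 + Real.sin θ • b 1)) := by
  have hu : ContDiff ℝ n (fun θ : ℝ => Real.cos θ • b 0 + Real.sin θ • b 1) :=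
    contDiff_circleMap_basis b
  refine contDiff_iff_contDiffAt.2 fun θ => ?_
  have hne : Real.cos θ • b 0 + Real.sin θ • b 1 ≠ 0 := by
    intro h0
    have := norm_circleMap_basis b θ
    rw [h0, norm_zero] at this
    exact zero_ne_one this
  have h1 : ContDiffAt ℝ n (fun θ : ℝ => ρ (Real.cos θ • b 0 + Real.sin θ • b 1)) θ :=
    (hρ _ hne).comp θ hu.contDiffAt
  exact contDiffAt_const.add (h1.smul hu.contDiffAt)

end Radial

/-! ### Constant-speed reparametrisation of a closed regular `C¹` curve -/

section Reparam

omit [InnerProductSpace ℝ E] [CompleteSpace E] in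
/-- The arclength construction behind `exists_constSpeed_reparam`, recording in addition the
derivative `τ' = P⁻¹ / ‖γ₀' ∘ τ‖` of the change of parameter (p.9 L57–59:
"`∂θ/∂θ̃ ∂_θ p = (1/(P v(0,θ))) ∂_θ p`"). [folklore] -/
private theorem exists_constSpeed_reparam_core [NormedSpace ℝ E] {γ₀ γ₀' : ℝ → E} {T : ℝ}
    (hT : 0 < T) (hper : Function.Periodic γ₀ T) (hder : ∀ φ, HasDerivAt γ₀ (γ₀' φ) φ)
    (hcont : Continuous γ₀') (hne : ∀ φ, γ₀' φ ≠ 0) :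
    ∃ (τ : ℝ → ℝ) (P : ℝ), 0 < P ∧ StrictMono τ ∧ Continuous τ ∧
      (∀ θ, HasDerivAt τ (P⁻¹ * ‖γ₀' (τ θ)‖⁻¹) θ) ∧
      BijOn τ (Ico 0 (2 * Real.pi)) (Ico 0 T) ∧
      Function.Periodic (fun θ => γ₀ (τ θ)) (2 * Real.pi) ∧
      (∀ θ, HasDerivAt (fun θ => γ₀ (τ θ)) ((P⁻¹ * ‖γ₀' (τ θ)‖⁻¹) • γ₀' (τ θ)) θ) ∧
      ∀ θ, ‖(P⁻¹ * ‖γ₀' (τ θ)‖⁻¹) • γ₀' (τ θ)‖ = P⁻¹ := by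
  -- the speed `w = ‖γ₀'‖` is continuous, positive and `T`-periodic
  set w : ℝ → ℝ := fun φ => ‖γ₀' φ‖ with hw
  have hwc : Continuous w := continuous_norm.comp hcont
  have hwpos : ∀ φ, 0 < w φ := fun φ => norm_pos_iff.2 (hne φ)
  have hγ'per : Function.Periodic γ₀' T := by
    intro φ
    have h2 : HasDerivAt (fun x => γ₀ (x + T)) (γ₀' (φ + T)) φ :=
      HasDerivAt.comp_add_const φ T (hder (φ + T))
    have h3 : HasDerivAt γ₀ (γ₀' (φ + T)) φ := by
      have : (fun x => γ₀ (x + T)) = γ₀ := funext hper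
      rw [this] at h2; exact h2
    exact h3.unique (hder φ)
  have hwper : Function.Periodic w T := fun φ => by simp only [hw, hγ'per φ]
  -- a positive lower bound `m ≤ w`
  obtain ⟨φm, -, hmin⟩ := (isCompact_Icc (a := (0 : ℝ)) (b := T)).exists_isMinOn
    (nonempty_Icc.2 hT.le) hwc.continuousOn
  set m : ℝ := w φm with hm
  have hmpos : 0 < m := hwpos φm
  have hmle : ∀ φ, m ≤ w φ := by
    intro φ
    obtain ⟨y, hy, hyeq⟩ := hwper.exists_mem_Ico₀ hT φ
    rw [hyeq]
    exact hmin (Ico_subset_Icc_self hy)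
  -- the arclength function `S`
  set S : ℝ → ℝ := fun φ => ∫ x in (0 : ℝ)..φ, w x with hS
  have hSd : ∀ φ, HasDerivAt S (w φ) φ := fun φ => (hwc.integral_hasStrictDerivAt 0 φ).hasDerivAt
  have hS0 : S 0 = 0 := by simp [hS]
  have hSmono : StrictMono S :=
    strictMono_of_deriv_pos fun φ => by rw [(hSd φ).deriv]; exact hwpos φ
  have hScont : Continuous S := continuous_iff_continuousAt.2 fun φ => (hSd φ).continuousAt
  set ℓ : ℝ := S T with hℓ
  have hℓpos : 0 < ℓ := by rw [hℓ, ← hS0]; exact hSmono hT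
  have hSper : ∀ φ, S (φ + T) = S φ + ℓ := by
    intro φ
    have hi : ∀ a c : ℝ, IntervalIntegrable w MeasureTheory.volume a c :=
      fun a c => hwc.intervalIntegrable a c
    simp only [hS, hℓ]
    rw [← intervalIntegral.integral_add_adjacent_intervals (hi 0 φ) (hi φ (φ + T)),
      hwper.intervalIntegral_add_eq φ 0, zero_add]
  -- linear growth, hence surjectivity
  have hDd : ∀ φ, HasDerivAt (fun φ => S φ - m * φ) (w φ - m * 1) φ :=
    fun φ => (hSd φ).sub ((hasDerivAt_id φ).const_mul m)
  have hD : Monotone (fun φ => S φ - m * φ) := by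
    apply monotone_of_deriv_nonneg
    · exact fun φ => (hDd φ).differentiableAt
    · intro φ
      rw [(hDd φ).deriv]
      linarith [hmle φ]
  have hSsurj : Function.Surjective S := by
    apply hScont.surjective
    · refine tendsto_atTop_mono' atTop ?_ (tendsto_id.const_mul_atTop hmpos)
      filter_upwards [eventually_ge_atTop (0 : ℝ)] with φ hφ
      have := hD hφ
      simp only [mul_zero, sub_zero, hS0, id] at this ⊢
      linarith
    · refine tendsto_atBot_mono' atBot ?_ (tendsto_id.const_mul_atBot hmpos)
      filter_upwards [eventually_le_atBot (0 : ℝ)] with φ hφ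
      have := hD hφ
      simp only [mul_zero, sub_zero, hS0, id] at this ⊢
      linarith
  -- the inverse `τ₀` of `S`
  set Φ : ℝ ≃o ℝ := hSmono.orderIsoOfSurjective S hSsurj with hΦ
  set τ₀ : ℝ → ℝ := fun θ => Φ.symm θ with hτ₀
  have hSτ₀ : ∀ θ, S (τ₀ θ) = θ := fun θ =>
    StrictMono.orderIsoOfSurjective_self_symm_apply S hSmono hSsurj θ
  have hτ₀S : ∀ φ, τ₀ (S φ) = φ := fun φ =>
    StrictMono.orderIsoOfSurjective_symm_apply_self S hSmono hSsurj φ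
  have hτ₀mono : StrictMono τ₀ := Φ.symm.strictMono
  have hτ₀cont : Continuous τ₀ := Φ.symm.continuous
  have hτ₀d : ∀ θ, HasDerivAt τ₀ (w (τ₀ θ))⁻¹ θ := fun θ =>
    HasDerivAt.of_local_left_inverse hτ₀cont.continuousAt (hSd (τ₀ θ)) (hwpos _).ne'
      (Eventually.of_forall fun y => hSτ₀ y)
  have hτ₀per : ∀ θ, τ₀ (θ + ℓ) = τ₀ θ + T := by
    intro θ
    apply hSmono.injective
    rw [hSτ₀, hSper, hSτ₀]
  have hτ₀0 : τ₀ 0 = 0 := by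
    have := hτ₀S 0
    rwa [hS0] at this
  have hτ₀ℓ : τ₀ ℓ = T := hτ₀S T
  -- rescale: `τ θ = τ₀ (k θ)`, `k = ℓ / 2π = P⁻¹`
  set k : ℝ := ℓ / (2 * Real.pi) with hk
  have hkpos : 0 < k := by positivity
  have hk2π : k * (2 * Real.pi) = ℓ := by rw [hk]; field_simp
  set τ : ℝ → ℝ := fun θ => τ₀ (k * θ) with hτ
  set P : ℝ := 2 * Real.pi / ℓ with hP
  have hPpos : 0 < P := by positivity
  have hPk : P⁻¹ = k := by rw [hP, hk, inv_div]
  have hτd : ∀ θ, HasDerivAt τ ((w (τ θ))⁻¹ * k) θ := by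
    intro θ
    have h1 : HasDerivAt (fun θ : ℝ => k * θ) k θ := by
      simpa using (hasDerivAt_id θ).const_mul k
    exact (hτ₀d (k * θ)).comp θ h1
  refine ⟨τ, P, hPpos, ?_, ?_, ?_, ?_, ?_, ?_, ?_⟩
  · exact fun θ₁ θ₂ h => hτ₀mono (mul_lt_mul_of_pos_left h hkpos)
  · exact hτ₀cont.comp (continuous_const.mul continuous_id)
  · intro θ
    rw [hPk, mul_comm]
    exact hτd θ
  · refine ⟨?_, ?_, ?_⟩
    · intro θ hθ
      refine ⟨?_, ?_⟩
      · show 0 ≤ τ₀ (k * θ)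
        rw [← hτ₀0]; exact hτ₀mono.monotone (mul_nonneg hkpos.le hθ.1)
      · show τ₀ (k * θ) < T
        rw [← hτ₀ℓ]; apply hτ₀mono
        calc k * θ < k * (2 * Real.pi) := mul_lt_mul_of_pos_left hθ.2 hkpos
          _ = ℓ := hk2π
    · exact (StrictMono.injective fun θ₁ θ₂ h => hτ₀mono (mul_lt_mul_of_pos_left h hkpos)).injOn
    · intro φ hφ
      refine ⟨S φ / k, ⟨?_, ?_⟩, ?_⟩
      · have : S 0 ≤ S φ := hSmono.monotone hφ.1
        rw [hS0] at this
        positivity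
      · rw [div_lt_iff₀ hkpos, mul_comm, hk2π, hℓ]
        exact hSmono hφ.2
      · show τ₀ (k * (S φ / k)) = φ
        rw [mul_div_cancel₀ _ hkpos.ne', hτ₀S]
  · intro θ
    show γ₀ (τ₀ (k * (θ + 2 * Real.pi))) = γ₀ (τ₀ (k * θ))
    rw [mul_add, hk2π, hτ₀per, hper]
  · intro θ
    have h := (hder (τ θ)).scomp θ (hτd θ)
    rw [hPk, mul_comm]
    exact h
  · intro θ
    rw [norm_smul, Real.norm_eq_abs, abs_of_pos (mul_pos (inv_pos.2 hPpos) (inv_pos.2 (hwpos _))),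
      mul_assoc]
    show P⁻¹ * ((w (τ θ))⁻¹ * w (τ θ)) = P⁻¹
    rw [inv_mul_cancel₀ (hwpos _).ne', mul_one]

omit [InnerProductSpace ℝ E] [CompleteSpace E] in
/-- **Arclength reparametrisation** ([II] §2.2 p.9 L40–71: "`θ̃(θ) = P ∫_{θ₀}^{θ} dϑ v(0,ϑ)` … is a
diffeomorphism because `v(0,θ) > 0` … `|∂_θ̃ p̃(0,θ̃)| = 1/P` for all `θ̃` … choose `P` such that the
period is `2π`"). A `T`-periodic curve with continuous non-vanishing velocity admits a `2π`-periodic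
reparametrisation of constant speed `1/P` (`P = 2π / length`) through a strictly increasing continuous
change of parameter that maps `[0, 2π)` onto `[0, T)`.
[cite: FeldmanSalmhoferTrubowitz1998, §2.2 (arXiv p.9 L40–71)] -/
theorem exists_constSpeed_reparam [NormedSpace ℝ E] {γ₀ γ₀' : ℝ → E} {T : ℝ} (hT : 0 < T)
    (hper : Function.Periodic γ₀ T) (hder : ∀ φ, HasDerivAt γ₀ (γ₀' φ) φ)
    (hcont : Continuous γ₀') (hne : ∀ φ, γ₀' φ ≠ 0) :
    ∃ (τ : ℝ → ℝ) (P : ℝ), 0 < P ∧ StrictMono τ ∧ Continuous τ ∧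
      BijOn τ (Ico 0 (2 * Real.pi)) (Ico 0 T) ∧
      Function.Periodic (fun θ => γ₀ (τ θ)) (2 * Real.pi) ∧
      (∀ θ, HasDerivAt (fun θ => γ₀ (τ θ)) ((P⁻¹ * ‖γ₀' (τ θ)‖⁻¹) • γ₀' (τ θ)) θ) ∧
      ∀ θ, ‖(P⁻¹ * ‖γ₀' (τ θ)‖⁻¹) • γ₀' (τ θ)‖ = P⁻¹ := by
  obtain ⟨τ, P, hP, hmono, hcont', -, hbij, hper', hder', hnorm⟩ :=
    exists_constSpeed_reparam_core hT hper hder hcont hne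
  exact ⟨τ, P, hP, hmono, hcont', hbij, hper', hder', hnorm⟩

/-- **Bootstrap for the regularity of the change of parameter**: if `τ' = g ∘ τ` with `g ∈ C^m`, then
`τ ∈ C^{m+1}` (p.9 L52–53: "`v(0,θ)` is `C^{k-1}`, so the map `θ ↦ θ̃` is `C^k`" — for the inverse
map `θ̃ ↦ θ`). [folklore] -/
private theorem contDiff_succ_of_hasDerivAt_comp {m : ℕ} {τ g : ℝ → ℝ} (hg : ContDiff ℝ m g)
    (hτ : ∀ θ, HasDerivAt τ (g (τ θ)) θ) : ContDiff ℝ (m + 1) τ := by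
  induction m with
  | zero =>
    have hd : Differentiable ℝ τ := fun θ => (hτ θ).differentiableAt
    have hderiv : deriv τ = fun θ => g (τ θ) := funext fun θ => (hτ θ).deriv
    rw [show ((0 : ℕ) : WithTop ℕ∞) + 1 = 1 by norm_num, contDiff_one_iff_deriv, hderiv]
    exact ⟨hd, hg.continuous.comp hd.continuous⟩
  | succ m ih =>
    have hτm : ContDiff ℝ (m + 1) τ := ih (hg.of_le (by norm_num))
    have hderiv : deriv τ = fun θ => g (τ θ) := funext fun θ => (hτ θ).deriv
    rw [show ((m + 1 : ℕ) : WithTop ℕ∞) + 1 = (m + 1 : ℕ) + 1 by norm_num, contDiff_succ_iff_deriv]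
    refine ⟨fun θ => (hτ θ).differentiableAt, fun h => absurd h (by simp), ?_⟩
    rw [hderiv]
    exact hg.comp hτm

omit [CompleteSpace E] in
/-- **Arclength reparametrisation, `C^k` version** ([II] §2.2 p.9 L52–59: "`v(0,θ)` is `C^{k-1}`, so the
map `θ ↦ θ̃` is `C^k`. It is a diffeomorphism because `v(0,θ) > 0` … `∂_θ̃ p̃ = (∂θ/∂θ̃) ∂_θ p`"): for a
`T`-periodic `C^k` curve (`k ≥ 1`) in an inner-product space with nowhere-vanishing velocity, the change
of parameter of `exists_constSpeed_reparam` and the reparametrised curve are `C^k`.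
[cite: FeldmanSalmhoferTrubowitz1998, §2.2 (arXiv p.9 L40–71)] -/
theorem exists_constSpeed_reparam_contDiff {γ₀ : ℝ → E} {T : ℝ} {k : ℕ} (hk : 1 ≤ k) (hT : 0 < T)
    (hper : Function.Periodic γ₀ T) (hγ : ContDiff ℝ k γ₀) (hne : ∀ φ, deriv γ₀ φ ≠ 0) :
    ∃ (τ : ℝ → ℝ) (P : ℝ), 0 < P ∧ StrictMono τ ∧ ContDiff ℝ k τ ∧
      BijOn τ (Ico 0 (2 * Real.pi)) (Ico 0 T) ∧
      Function.Periodic (fun θ => γ₀ (τ θ)) (2 * Real.pi) ∧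
      ContDiff ℝ k (fun θ => γ₀ (τ θ)) ∧
      (∀ θ, HasDerivAt (fun θ => γ₀ (τ θ)) ((P⁻¹ * ‖deriv γ₀ (τ θ)‖⁻¹) • deriv γ₀ (τ θ)) θ) ∧
      ∀ θ, ‖(P⁻¹ * ‖deriv γ₀ (τ θ)‖⁻¹) • deriv γ₀ (τ θ)‖ = P⁻¹ := by
  obtain ⟨m, rfl⟩ : ∃ m, k = m + 1 := ⟨k - 1, by omega⟩
  have hk' : ((m + 1 : ℕ) : WithTop ℕ∞) = (m : WithTop ℕ∞) + 1 := by push_cast; ring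
  have hγ' : ContDiff ℝ m (deriv γ₀) := by
    rw [hk', contDiff_succ_iff_deriv] at hγ
    exact hγ.2.2
  have hdiff : Differentiable ℝ γ₀ := hγ.differentiable (by simp)
  have hder : ∀ φ, HasDerivAt γ₀ (deriv γ₀ φ) φ := fun φ => (hdiff φ).hasDerivAt
  obtain ⟨τ, P, hP, hmono, hcont', hτd, hbij, hper', hder', hnorm⟩ :=
    exists_constSpeed_reparam_core hT hper hder hγ'.continuous hne
  -- `τ' = g ∘ τ` with `g = P⁻¹ / ‖γ₀'‖ ∈ C^m`
  have hg : ContDiff ℝ m (fun φ => P⁻¹ * ‖deriv γ₀ φ‖⁻¹) := by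
    refine contDiff_const.mul (ContDiff.inv ?_ fun φ => norm_ne_zero_iff.2 (hne φ))
    exact contDiff_iff_contDiffAt.2 fun φ => (contDiffAt_norm ℝ (hne φ)).comp φ hγ'.contDiffAt
  have hτC : ContDiff ℝ (m + 1) τ := contDiff_succ_of_hasDerivAt_comp hg hτd
  have hτC' : ContDiff ℝ ((m + 1 : ℕ) : WithTop ℕ∞) τ := by rw [hk']; exact hτC
  exact ⟨τ, P, hP, hmono, hτC', hbij, hper', hγ.comp hτC', hder', hnorm⟩

end Reparam

/-! ### Assembly: the constant-speed angular coordinate on the boundary of a planar convex body cut out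
by a regular equation; `FermiCurveParam cr e` is inhabited under (A2), (A3, global half), `d = 2` -/

section Assembly

/-- The construction behind `exists_constSpeed_param_frontier` /
`exists_contDiff_constSpeed_param_frontier`, for `e ∈ C^k`, `k ≥ 1`. [folklore] -/
private theorem exists_constSpeed_param_frontier_core (hd : Module.finrank ℝ E = 2) {C : Set E}
    (hC : IsCompact C) (hconv : Convex ℝ C) (hint : (interior C).Nonempty) {e : E → ℝ} {k : ℕ}
    (hk : 1 ≤ k) (he : ContDiff ℝ k e) (hzero : ∀ p ∈ frontier C, e p = 0)
    (hgrad : ∀ p ∈ frontier C, gradient e p ≠ 0) :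
    ∃ (γ dγ : ℝ → E) (P : ℝ), 0 < P ∧ Function.Periodic γ (2 * Real.pi) ∧
      (∀ θ, γ θ ∈ frontier C) ∧ frontier C ⊆ γ '' Ico 0 (2 * Real.pi) ∧
      InjOn γ (Ico 0 (2 * Real.pi)) ∧ (∀ θ, HasDerivAt γ (dγ θ) θ) ∧ (∀ θ, ‖dγ θ‖ = P⁻¹) ∧
      Continuous dγ ∧ ContDiff ℝ k γ := by
  haveI : FiniteDimensional ℝ E := Module.finite_of_finrank_eq_succ hd
  set b : OrthonormalBasis (Fin 2) ℝ E := (stdOrthonormalBasis ℝ E).reindex (finCongr hd) with hb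
  obtain ⟨c, hc⟩ := hint
  -- the translated body `s = C - c`, a bounded convex neighbourhood of `0`
  set s : Set E := (fun x => c + x) ⁻¹' C with hs
  have hsc : Convex ℝ s := hconv.translate_preimage_right c
  have hs0 : s ∈ 𝓝 (0 : E) := by
    have hcont : ContinuousAt (fun x : E => c + x) 0 :=
      (continuous_const.add continuous_id).continuousAt
    have hC0 : C ∈ 𝓝 (c + (0 : E)) := by rw [add_zero]; exact mem_interior_iff_mem_nhds.1 hc
    exact hcont.preimage_mem_nhds hC0
  have hsb : Bornology.IsVonNBounded ℝ s := by
    obtain ⟨R, hR⟩ := (Metric.isBounded_iff_subset_closedBall c).1 hC.isBounded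
    refine (NormedSpace.isVonNBounded_closedBall ℝ E R).subset fun x hx => ?_
    have h1 : c + x ∈ Metric.closedBall c R := hR hx
    rw [Metric.mem_closedBall, dist_eq_norm, add_sub_cancel_left] at h1
    rwa [Metric.mem_closedBall, dist_zero_right]
  -- `gauge s x = 1 ↔ c + x ∈ ∂C`
  have hfront : ∀ x : E, gauge s x = 1 ↔ c + x ∈ frontier C := by
    intro x
    rw [gauge_eq_one_iff_mem_frontier hsc hs0]
    have h2 : frontier s = (Homeomorph.addLeft c) ⁻¹' frontier C := by
      rw [(Homeomorph.addLeft c).preimage_frontier C]; rfl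
    rw [h2]; rfl
  have hzero' : ∀ x, gauge s x = 1 → e (c + x) = 0 := fun x hx => hzero _ ((hfront x).1 hx)
  have hgrad' : ∀ x, gauge s x = 1 → gradient e (c + x) ≠ 0 :=
    fun x hx => hgrad _ ((hfront x).1 hx)
  -- the radial function `ρ = 1/g`, the circle `u`, its velocity `u'`, the radial curve `γ₀`
  set ρ : E → ℝ := fun y => (gauge s y)⁻¹ with hρ
  set u : ℝ → E := fun φ => Real.cos φ • b 0 + Real.sin φ • b 1 with hu
  set u' : ℝ → E := fun φ => -Real.sin φ • b 0 + Real.cos φ • b 1 with hu'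
  set γ₀ : ℝ → E := fun φ => c + ρ (u φ) • u φ with hγ₀
  have hune : ∀ φ, u φ ≠ 0 := by
    intro φ h0
    have h1 : ‖u φ‖ = 1 := norm_circleMap_basis b φ
    rw [h0, norm_zero] at h1
    exact zero_ne_one h1
  have hρpos : ∀ φ, 0 < ρ (u φ) := fun φ =>
    inv_pos.2 ((gauge_pos (absorbent_nhds_zero hs0) hsb).2 (hune φ))
  have hk1 : (1 : WithTop ℕ∞) ≤ k := by exact_mod_cast hk
  have hk0 : (k : WithTop ℕ∞) ≠ 0 := by exact_mod_cast (show k ≠ 0 by omega)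
  have hρC : ∀ x : E, x ≠ 0 → ContDiffAt ℝ k ρ x := fun x hx =>
    contDiffAt_inv_gauge hsc hs0 hsb hk1 he hzero' hgrad' hx
  have hγ₀Ck : ContDiff ℝ k γ₀ := contDiff_radialCurve_of_contDiffAt b c hρC
  have hγ₀C : ContDiff ℝ 1 γ₀ := hγ₀Ck.of_le hk1
  have hγ₀per : Function.Periodic γ₀ (2 * Real.pi) := by
    intro φ
    simp only [hγ₀, hu, Real.cos_add_two_pi, Real.sin_add_two_pi]
  -- the velocity of `γ₀` and its non-vanishing
  have hγ₀d : ∀ φ, HasDerivAt γ₀ (ρ (u φ) • u' φ + (fderiv ℝ ρ (u φ) (u' φ)) • u φ) φ := by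
    intro φ
    have hρd : HasFDerivAt ρ (fderiv ℝ ρ (u φ)) (u φ) :=
      ((hρC _ (hune φ)).differentiableAt hk0).hasFDerivAt
    exact hasDerivAt_radialCurve c (hasDerivAt_circleMap_basis b φ) hρd
  have hderiv : ∀ φ, deriv γ₀ φ = ρ (u φ) • u' φ + (fderiv ℝ ρ (u φ) (u' φ)) • u φ :=
    fun φ => (hγ₀d φ).deriv
  have hγ₀'cont : Continuous (deriv γ₀) := hγ₀C.continuous_deriv le_rfl
  have hγ₀'ne : ∀ φ, deriv γ₀ φ ≠ 0 := by
    intro φ h0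
    have h1 : inner ℝ (deriv γ₀ φ) (u' φ) = ρ (u φ) := by
      rw [hderiv]
      exact inner_radialVelocity b (ρ (u φ)) (fderiv ℝ ρ (u φ) (u' φ)) φ
    rw [h0, inner_zero_left] at h1
    exact (hρpos φ).ne h1
  -- constant-speed reparametrisation
  obtain ⟨τ, P, hP, hτmono, hτC, hτbij, hγper, hγC, hγd, hγnorm⟩ :=
    exists_constSpeed_reparam_contDiff hk Real.two_pi_pos hγ₀per hγ₀Ck hγ₀'ne
  have hτcont : Continuous τ := hτC.continuous
  refine ⟨fun θ => γ₀ (τ θ), fun θ => (P⁻¹ * ‖deriv γ₀ (τ θ)‖⁻¹) • deriv γ₀ (τ θ), P, hP, hγper,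
    ?_, ?_, ?_, hγd, hγnorm, ?_, hγC⟩
  · -- `γ θ ∈ ∂C`
    intro θ
    show c + ρ (u (τ θ)) • u (τ θ) ∈ frontier C
    exact (hfront _).1 (gauge_radialParam b hs0 hsb (τ θ))
  · -- `∂C ⊆ γ '' [0, 2π)`
    intro p hp
    have hx : gauge s (p - c) = 1 := (hfront _).2 (by rwa [add_sub_cancel])
    obtain ⟨φ, hφ, hφeq⟩ := exists_radialParam_eq b hx
    obtain ⟨θ, hθ, hθeq⟩ := hτbij.surjOn hφ
    refine ⟨θ, hθ, ?_⟩
    show c + ρ (u (τ θ)) • u (τ θ) = p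
    have h1 : ρ (u φ) • u φ = p - c := hφeq
    rw [hθeq, h1, add_sub_cancel]
  · -- injective on `[0, 2π)`
    intro θ₁ hθ₁ θ₂ hθ₂ heq
    have h1 : τ θ₁ ∈ Ico 0 (2 * Real.pi) := hτbij.mapsTo hθ₁
    have h2 : τ θ₂ ∈ Ico 0 (2 * Real.pi) := hτbij.mapsTo hθ₂
    change c + ρ (u (τ θ₁)) • u (τ θ₁) = c + ρ (u (τ θ₂)) • u (τ θ₂) at heq
    have heq' : ρ (u (τ θ₁)) • u (τ θ₁) = ρ (u (τ θ₂)) • u (τ θ₂) := add_left_cancel heq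
    exact hτmono.injective (injOn_radialParam b hs0 hsb h1 h2 heq')
  · -- `dγ` is continuous
    have hw : Continuous fun θ => deriv γ₀ (τ θ) := hγ₀'cont.comp hτcont
    exact (continuous_const.mul (hw.norm.inv₀ fun θ => norm_ne_zero_iff.2 (hγ₀'ne _))).smul hw

/-- **The boundary of a planar compact convex body cut out by a regular `C¹` equation is a closed regular
`C¹` curve, parametrised at constant speed** ([II] §2.2 p.9 L40–62: "in two dimensions … `θ ∈ ℝ/2πℤ`,
`|∂_θ p(0,θ)| = 1/P`"; Assumption A3 p.7 L59–60: "`S` bounds a strictly convex set. In two dimensions, `S`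
is a simple closed curve"). If `dim E = 2`, `C ⊆ E` is compact and convex with an interior point, and
`e ∈ C¹(E)` vanishes on `∂C` with `∇e ≠ 0` there, then there are a `2π`-periodic `γ : ℝ → E`, injective
on `[0, 2π)` with `γ '' [0, 2π) ⊇ ∂C ∋ γ θ`, and `P > 0`, with `γ' = dγ` continuous of constant length
`1/P`. (Construction: radial parametrisation `φ ↦ c + u(φ)/g(u(φ))` by the gauge `g` of `C - c`, `c` an
interior point — transversal to `∂C` by `inner_gradient_ne_zero_of_gauge`, `C¹` by
`contDiffAt_inv_gauge` — followed by the arclength reparametrisation `exists_constSpeed_reparam`.)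
[cite: FeldmanSalmhoferTrubowitz1998, §2.2 (arXiv p.9 L40–62)] -/
theorem exists_constSpeed_param_frontier (hd : Module.finrank ℝ E = 2) {C : Set E} (hC : IsCompact C)
    (hconv : Convex ℝ C) (hint : (interior C).Nonempty) {e : E → ℝ} (he : ContDiff ℝ 1 e)
    (hzero : ∀ p ∈ frontier C, e p = 0) (hgrad : ∀ p ∈ frontier C, gradient e p ≠ 0) :
    ∃ (γ dγ : ℝ → E) (P : ℝ), 0 < P ∧ Function.Periodic γ (2 * Real.pi) ∧
      (∀ θ, γ θ ∈ frontier C) ∧ frontier C ⊆ γ '' Ico 0 (2 * Real.pi) ∧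
      InjOn γ (Ico 0 (2 * Real.pi)) ∧ (∀ θ, HasDerivAt γ (dγ θ) θ) ∧ (∀ θ, ‖dγ θ‖ = P⁻¹) ∧
      Continuous dγ := by
  obtain ⟨γ, dγ, P, hP, hper, hmem, hsurj, hinj, hder, hnorm, hcont, -⟩ :=
    exists_constSpeed_param_frontier_core hd hC hconv hint (k := 1) le_rfl (by exact_mod_cast he)
      hzero hgrad
  exact ⟨γ, dγ, P, hP, hper, hmem, hsurj, hinj, hder, hnorm, hcont⟩

/-- **`C^k` regularity of the constant-speed boundary parametrisation** ([II] §2.2 p.8 L94–98: "for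
`d = 2`, the variable `θ ∈ S¹` is simply an angular variable. The map is `(ρ,θ) ↦ p(ρ,θ)`. It is `C^k`
in both variables"; p.9 L52–53: "no differentiability is lost by this change of variables"): if
`e ∈ C^k`, `k ≥ 1`, the curve `γ` of `exists_constSpeed_param_frontier` can be taken `C^k` (with
`γ' = dγ`). [cite: FeldmanSalmhoferTrubowitz1998, §2.2 (arXiv p.8 L94–98, p.9 L40–71)] -/
theorem exists_contDiff_constSpeed_param_frontier (hd : Module.finrank ℝ E = 2) {C : Set E}
    (hC : IsCompact C) (hconv : Convex ℝ C) (hint : (interior C).Nonempty) {e : E → ℝ} {k : ℕ}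
    (hk : 1 ≤ k) (he : ContDiff ℝ k e) (hzero : ∀ p ∈ frontier C, e p = 0)
    (hgrad : ∀ p ∈ frontier C, gradient e p ≠ 0) :
    ∃ (γ dγ : ℝ → E) (P : ℝ), 0 < P ∧ Function.Periodic γ (2 * Real.pi) ∧
      (∀ θ, γ θ ∈ frontier C) ∧ frontier C ⊆ γ '' Ico 0 (2 * Real.pi) ∧
      InjOn γ (Ico 0 (2 * Real.pi)) ∧ (∀ θ, HasDerivAt γ (dγ θ) θ) ∧ (∀ θ, ‖dγ θ‖ = P⁻¹) ∧
      Continuous dγ ∧ ContDiff ℝ k γ :=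
  exists_constSpeed_param_frontier_core hd hC hconv hint hk he hzero hgrad

/-- **The angular coordinate of [II] §2.2 exists.** Under (A2)_{k,h} with `k ≥ 1` (`e ∈ C¹`, `∇e ≠ 0`
on `S`), the global half of (A3) (`S ∩ F = ∂C` for a compact strictly convex body `C` with interior,
`HypA3Global`) and `d = 2`, the datum `FermiCurveParam cr e` (a `2π`-periodic constant-speed regular
parametrisation of `S ∩ F`, injective on a period, `|∂_θ p| = 1/P`; p.9 L40–62), which
`FST2Hypotheses` carries as a parameter of (A4′) and of `antipodeAngularDeriv`, is inhabited. [II] builds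
it from the coordinates of [I, Lemma 2.1]; here it is built from the gauge of `C`
(`exists_constSpeed_param_frontier`); strict convexity is used only through convexity.
[cite: FeldmanSalmhoferTrubowitz1998, §2.2 (arXiv p.9 L40–62) with Assumption A3 (arXiv p.7 L59–60)] -/
theorem nonempty_fermiCurveParam (cr : Crystal E) (hd : Module.finrank ℝ E = 2) {e : E → ℝ} {k : ℕ}
    {h : ℝ≥0} (hk : 1 ≤ k) (hA2 : HypA2 cr k h e) (hG : HypA3Global cr e) :
    Nonempty (FermiCurveParam cr e) := by
  obtain ⟨C, hC, hsc, hint, hSF⟩ := hG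
  have he : ContDiff ℝ 1 e := hA2.memContDiffHolder.contDiff.of_le (by exact_mod_cast hk)
  have hzero : ∀ p ∈ frontier C, e p = 0 := fun p hp => by
    rw [← hSF] at hp
    exact hp.1
  have hgrad : ∀ p ∈ frontier C, gradient e p ≠ 0 := fun p hp =>
    hA2.gradient_ne_zero p (by rw [← hSF] at hp; exact hp.1)
  obtain ⟨γ, dγ, P, hP, hper, hmem, hsurj, hinj, hd', hnorm, -⟩ :=
    exists_constSpeed_param_frontier hd hC hsc.convex hint he hzero hgrad
  refine ⟨⟨γ, dγ, P, hP, hper, fun θ => ?_, ?_, hinj, hd', hnorm⟩⟩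
  · rw [hSF]
    exact hmem θ
  · rw [hSF]
    exact hsurj

/-- **The angular coordinate of [II] §2.2 is `C^k`** (p.8 L94–98: "the map `(ρ,θ) ↦ p(ρ,θ)` … is `C^k`
in both variables"): under (A2)_{k,h}, `k ≥ 1`, the global half of (A3) and `d = 2` there is a
`FermiCurveParam cr e` whose curve `θ ↦ p(0,θ)` is `C^k`, with continuous velocity field `dγ = γ'`.
[cite: FeldmanSalmhoferTrubowitz1998, §2.2 (arXiv p.8 L94–98, p.9 L40–71)] -/
theorem exists_fermiCurveParam_contDiff (cr : Crystal E) (hd : Module.finrank ℝ E = 2) {e : E → ℝ}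
    {k : ℕ} {h : ℝ≥0} (hk : 1 ≤ k) (hA2 : HypA2 cr k h e) (hG : HypA3Global cr e) :
    ∃ Θ : FermiCurveParam cr e, ContDiff ℝ k Θ.γ ∧ Continuous Θ.dγ ∧ ∀ θ, Θ.dγ θ = deriv Θ.γ θ := by
  obtain ⟨C, hC, hsc, hint, hSF⟩ := hG
  have he : ContDiff ℝ k e := hA2.memContDiffHolder.contDiff
  have hzero : ∀ p ∈ frontier C, e p = 0 := fun p hp => by
    rw [← hSF] at hp
    exact hp.1
  have hgrad : ∀ p ∈ frontier C, gradient e p ≠ 0 := fun p hp =>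
    hA2.gradient_ne_zero p (by rw [← hSF] at hp; exact hp.1)
  obtain ⟨γ, dγ, P, hP, hper, hmem, hsurj, hinj, hd', hnorm, hcont, hCk⟩ :=
    exists_contDiff_constSpeed_param_frontier hd hC hsc.convex hint hk he hzero hgrad
  refine ⟨⟨γ, dγ, P, hP, hper, fun θ => ?_, ?_, hinj, hd', hnorm⟩, hCk, hcont,
    fun θ => (hd' θ).deriv.symm⟩
  · rw [hSF]
    exact hmem θ
  · rw [hSF]
    exact hsurj

/-- The case of the volume bound and of Theorem 1.2 (i): (A2)_{2,0}, (A3) (global half), `d = 2` give the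
angular coordinate `θ` of [II] §2.2. [cite: FeldmanSalmhoferTrubowitz1998, §2.2 (arXiv p.9 L40–62)] -/
theorem nonempty_fermiCurveParam_of_hypA2_two (cr : Crystal E) (hd : Module.finrank ℝ E = 2)
    {e : E → ℝ} (hA2 : HypA2 cr 2 0 e) (hG : HypA3Global cr e) : Nonempty (FermiCurveParam cr e) :=
  nonempty_fermiCurveParam cr hd one_le_two hA2 hG

end Assembly

/-! ### The identities (Trick) along the Fermi curve, the `d = 2` curvature, and the orientation of
`∇e` on `S ∩ F = ∂C` ("`e < 0` inside `S`") -/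

section Orientation

/-- [II] Lemma 2.1, proof, eq. (Trick), first line · p.9 L13–15: "`e(p(ρ,θ)) = ρ` for all `θ`, so
`∇e(p(ρ,θ))·∂_θ p(ρ,θ) = 0`" — for any curve `γ` along which `e` vanishes, at a parameter where `γ`
and `e` are differentiable. [cite: FeldmanSalmhoferTrubowitz1998, Lemma 2.1 proof eq. (Trick) (arXiv p.9 L13–15)] -/
theorem inner_gradient_eq_zero_of_apply_comp_eq_zero {e : E → ℝ} {γ : ℝ → E} {dγ : E} {θ : ℝ}
    (he : DifferentiableAt ℝ e (γ θ)) (hγ : HasDerivAt γ dγ θ) (hzero : ∀ t, e (γ t) = 0) :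
    inner ℝ (gradient e (γ θ)) dγ = 0 := by
  have h1 : HasDerivAt (fun t => e (γ t)) (fderiv ℝ e (γ θ) dγ) θ :=
    he.hasFDerivAt.comp_hasDerivAt θ hγ
  have h2 : HasDerivAt (fun t => e (γ t)) 0 θ := by
    have h0 : (fun t => e (γ t)) = fun _ => (0 : ℝ) := funext hzero
    rw [h0]
    exact hasDerivAt_const θ 0
  rw [inner_gradient_left]
  exact h1.unique h2

/-- [II] Lemma 2.1, proof, eq. (Trick), second line · p.9 L13–18: "and
`w(p(ρ,θ)) + ∇e(p(ρ,θ))·∂²_θ p(ρ,θ) = 0`", where `w(p) = (∂_θ p, e''(p) ∂_θ p)` ((wpdef) p.8 L113–116) is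
`hessQuad e p (∂_θ p)` — for any differentiable curve `γ` with velocity field `dγ` differentiable at
`θ`, along which `e ∈ C²` vanishes. [cite: FeldmanSalmhoferTrubowitz1998, Lemma 2.1 proof eq. (Trick) (arXiv p.9 L13–18)] -/
theorem hessQuad_add_inner_gradient_eq_zero {e : E → ℝ} (he : ContDiff ℝ 2 e) {γ dγ : ℝ → E}
    {ddγ : E} {θ : ℝ} (hγ : ∀ t, HasDerivAt γ (dγ t) t) (hdγ : HasDerivAt dγ ddγ θ)
    (hzero : ∀ t, e (γ t) = 0) :
    hessQuad e (γ θ) (dγ θ) + inner ℝ (gradient e (γ θ)) ddγ = 0 := by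
  have hdiff : Differentiable ℝ e := he.differentiable (by norm_num)
  have hF0 : ∀ t, fderiv ℝ e (γ t) (dγ t) = 0 := fun t => by
    rw [← inner_gradient_left]
    exact inner_gradient_eq_zero_of_apply_comp_eq_zero (hdiff _) (hγ t) hzero
  have hfd : DifferentiableAt ℝ (fderiv ℝ e) (γ θ) :=
    ((he.fderiv_right (m := 1) le_rfl).differentiable one_ne_zero) (γ θ)
  have hc : HasDerivAt (fun t => fderiv ℝ e (γ t)) (fderiv ℝ (fderiv ℝ e) (γ θ) (dγ θ)) θ :=
    hfd.hasFDerivAt.comp_hasDerivAt θ (hγ θ)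
  have hF : HasDerivAt (fun t => fderiv ℝ e (γ t) (dγ t))
      (fderiv ℝ (fderiv ℝ e) (γ θ) (dγ θ) (dγ θ) + fderiv ℝ e (γ θ) ddγ) θ := hc.clm_apply hdγ
  have hF' : HasDerivAt (fun t => fderiv ℝ e (γ t) (dγ t)) 0 θ := by
    have h0 : (fun t => fderiv ℝ e (γ t) (dγ t)) = fun _ => (0 : ℝ) := funext hF0
    rw [h0]
    exact hasDerivAt_const θ 0
  have key := hF.unique hF'
  unfold hessQuad
  rw [iteratedFDeriv_two_apply, inner_gradient_left]
  simpa using key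

omit [CompleteSpace E] in
/-- For a curve of constant speed the acceleration is orthogonal to the velocity ([II] (frene) p.8
L117–126 in the constant-speed coordinate, where `∂²s/∂θ² = 0`: `∂²_θ p = ±κ (∂s/∂θ)² n`).
[cite: FeldmanSalmhoferTrubowitz1998, §2.2 eq. (frene) (arXiv p.8 L117–126)] -/
theorem inner_eq_zero_of_norm_eq_const {dγ : ℝ → E} {ddγ : E} {θ c : ℝ} (hnorm : ∀ t, ‖dγ t‖ = c)
    (hdγ : HasDerivAt dγ ddγ θ) : inner ℝ (dγ θ) ddγ = 0 := by
  have h1 : HasDerivAt (fun t => ‖dγ t‖ ^ 2) (2 * inner ℝ (dγ θ) ddγ) θ := hdγ.norm_sq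
  have h2 : HasDerivAt (fun t => ‖dγ t‖ ^ 2) 0 θ := by
    have h0 : (fun t => ‖dγ t‖ ^ 2) = fun _ => c ^ 2 := funext fun t => by rw [hnorm]
    rw [h0]
    exact hasDerivAt_const θ _
  have := h1.unique h2
  linarith

omit [CompleteSpace E] in
/-- `(a t, e''(p) a t) = a² (t, e''(p) t)`. [folklore] -/
private theorem hessQuad_smul' (e : E → ℝ) (p t : E) (a : ℝ) :
    hessQuad e p (a • t) = a ^ 2 * hessQuad e p t := by
  unfold hessQuad
  have h : (![a • t, a • t] : Fin 2 → E) = fun i => a • (![t, t] : Fin 2 → E) i := by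
    ext i; fin_cases i <;> simp
  rw [h, ContinuousMultilinearMap.map_smul_univ]
  simp [pow_two]

omit [CompleteSpace E] in
/-- In a plane, two vectors orthogonal to the same non-zero vector are proportional. [folklore] -/
private theorem exists_smul_of_inner_eq_zero_of_finrank_eq_two (hd : Module.finrank ℝ E = 2)
    {v a w : E} (hv : v ≠ 0) (hw : w ≠ 0) (ha : inner ℝ a v = 0) (hwv : inner ℝ w v = 0) :
    ∃ μ : ℝ, a = μ • w := by
  haveI : FiniteDimensional ℝ E := Module.finite_of_finrank_eq_succ hd
  set μ : ℝ := inner ℝ a w / inner ℝ w w with hμ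
  refine ⟨μ, ?_⟩
  by_contra hne
  set r : E := a - μ • w with hr
  have hr0 : r ≠ 0 := sub_ne_zero.2 hne
  have hww : inner ℝ w w ≠ 0 := inner_self_ne_zero.2 hw
  have hrw : inner ℝ r w = 0 := by
    rw [hr, inner_sub_left, real_inner_smul_left, hμ, div_mul_cancel₀ _ hww, sub_self]
  have hrv : inner ℝ r v = 0 := by
    rw [hr, inner_sub_left, real_inner_smul_left, ha, hwv, mul_zero, sub_self]
  have hvw : inner ℝ v w = 0 := by rw [real_inner_comm]; exact hwv
  have hvr : inner ℝ v r = 0 := by rw [real_inner_comm]; exact hrv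
  have hwr : inner ℝ w r = 0 := by rw [real_inner_comm]; exact hrw
  have hz : ∀ i : Fin 3, (![v, w, r] : Fin 3 → E) i ≠ 0 := by
    intro i
    fin_cases i
    · exact hv
    · exact hw
    · exact hr0
  have ho : Pairwise fun i j : Fin 3 => inner ℝ ((![v, w, r] : Fin 3 → E) i) (![v, w, r] j) = 0 := by
    intro i j hij
    fin_cases i <;> fin_cases j <;>
      first | exact absurd rfl hij | simp [hvw, hvr, hwr, hwv, hrv, hrw]
  have hli : LinearIndependent ℝ (![v, w, r] : Fin 3 → E) :=
    linearIndependent_of_ne_zero_of_inner_eq_zero hz ho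
  have hcard := hli.fintype_card_le_finrank
  rw [Fintype.card_fin, hd] at hcard
  omega

/-- **The curvature of the Fermi curve in `d = 2`** ([II] §2.1 p.7 L58–59 "`κ` is strictly positive
everywhere; in `d > 2` this is meant in the matrix sense"; Lemma 2.1 p.9 L1–4): in two dimensions the unit
tangent vectors at `p` are `±t`, so the tree's `levelCurvature e p` (the supremum of `(v, e''(p) v)/|∇e(p)|`
over unit tangent `v`) is `(t, e''(p) t)/|∇e(p)|` for either unit tangent `t`.
[cite: FeldmanSalmhoferTrubowitz1998, Lemma 2.1 (arXiv p.9 L1–4)] -/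
theorem levelCurvature_eq_of_finrank_eq_two (hd : Module.finrank ℝ E = 2) {e : E → ℝ} {p t : E}
    (hp : gradient e p ≠ 0) (ht1 : ‖t‖ = 1) (ht : inner ℝ (gradient e p) t = 0) :
    levelCurvature e p = hessQuad e p t / ‖gradient e p‖ := by
  have ht0 : t ≠ 0 := by
    intro h0; rw [h0, norm_zero] at ht1; exact zero_ne_one ht1
  have hset : (fun v : E => hessQuad e p v / ‖gradient e p‖) ''
      {v | ‖v‖ = 1 ∧ inner ℝ (gradient e p) v = 0} = {hessQuad e p t / ‖gradient e p‖} := by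
    apply Subset.antisymm
    · rintro _ ⟨v, ⟨hv1, hv⟩, rfl⟩
      have hvt : inner ℝ v (gradient e p) = 0 := by rw [real_inner_comm]; exact hv
      have htt : inner ℝ t (gradient e p) = 0 := by rw [real_inner_comm]; exact ht
      obtain ⟨μ, hμ⟩ := exists_smul_of_inner_eq_zero_of_finrank_eq_two hd hp ht0 hvt htt
      have hμ1 : μ ^ 2 = 1 := by
        have := congrArg (fun z : E => ‖z‖) hμ
        simp only [norm_smul, Real.norm_eq_abs, ht1, hv1, mul_one] at this
        nlinarith [sq_abs μ]
      show hessQuad e p v / ‖gradient e p‖ ∈ _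
      rw [hμ, hessQuad_smul', hμ1, one_mul]
      exact mem_singleton _
    · rintro _ rfl
      exact ⟨t, ⟨ht1, ht⟩, rfl⟩
  unfold levelCurvature
  rw [hset, csSup_singleton]

/-- [II] Lemma 2.1 (`\Lem\wBound`), first display · p.9 L1–4, in the angular coordinate of §2.2:
"`κ(ρ,θ) |∇e(p(ρ,θ))| = ∓ w(p(ρ,θ))/|∂_θ p(ρ,θ)|²`" at `ρ = 0`, with `w(p) = (∂_θ p, e''(p) ∂_θ p)` and
`|∂_θ p(0,θ)| = 1/P`: for the tree's (unsigned) `levelCurvature`,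
`κ(p(0,θ)) |∇e(p(0,θ))| = P² (∂_θ p, e''(p) ∂_θ p)`.
[cite: FeldmanSalmhoferTrubowitz1998, Lemma 2.1 (arXiv p.9 L1–4, L13–15)] -/
theorem FermiCurveParam.levelCurvature_mul_norm_gradient (hd : Module.finrank ℝ E = 2) {cr : Crystal E}
    {e : E → ℝ} (Θ : FermiCurveParam cr e) {θ : ℝ} (he : DifferentiableAt ℝ e (Θ.γ θ))
    (hp : gradient e (Θ.γ θ) ≠ 0) :
    levelCurvature e (Θ.γ θ) * ‖gradient e (Θ.γ θ)‖ = Θ.P ^ 2 * hessQuad e (Θ.γ θ) (Θ.dγ θ) := by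
  have hzero : ∀ t, e (Θ.γ t) = 0 := fun t => (Θ.mem t).1
  have hgv : inner ℝ (gradient e (Θ.γ θ)) (Θ.dγ θ) = 0 :=
    inner_gradient_eq_zero_of_apply_comp_eq_zero he (Θ.hasDerivAt θ) hzero
  have ht1 : ‖Θ.P • Θ.dγ θ‖ = 1 := by
    rw [norm_smul, Real.norm_eq_abs, abs_of_pos Θ.P_pos, Θ.norm_dγ, mul_inv_cancel₀ Θ.P_pos.ne']
  have ht : inner ℝ (gradient e (Θ.γ θ)) (Θ.P • Θ.dγ θ) = 0 := by
    rw [real_inner_smul_right, hgv, mul_zero]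
  rw [levelCurvature_eq_of_finrank_eq_two hd hp ht1 ht, hessQuad_smul',
    div_mul_cancel₀ _ (norm_ne_zero_iff.2 hp)]

/-- At a maximum of `h` where `h'' ` exists (as `deriv (deriv h)`), `h'' ≤ 0`: if it were positive the
second-derivative test would make the maximum a local minimum too, so `h` would be locally constant and
`h'' = 0`. [folklore] -/
private theorem deriv_deriv_nonpos_of_forall_le {h : ℝ → ℝ} {θ₀ : ℝ} (hmax : ∀ θ, h θ ≤ h θ₀)
    (hc : ContinuousAt h θ₀) (hd : deriv h θ₀ = 0) : deriv (deriv h) θ₀ ≤ 0 := by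
  by_contra hpos
  push Not at hpos
  have hmin : IsLocalMin h θ₀ := isLocalMin_of_deriv_deriv_pos hpos hd hc
  have hmin' : ∀ᶠ θ in 𝓝 θ₀, h θ₀ ≤ h θ := hmin
  have hconst : ∀ᶠ θ in 𝓝 θ₀, h θ = h θ₀ := hmin'.mono fun θ hθ => le_antisymm (hmax θ) hθ
  obtain ⟨U, hU, hUo, hθ₀U⟩ := _root_.eventually_nhds_iff.1 hconst
  have hderiv : deriv h =ᶠ[𝓝 θ₀] fun _ => 0 := by
    filter_upwards [hUo.mem_nhds hθ₀U] with θ hθ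
    have hloc : h =ᶠ[𝓝 θ] fun _ => h θ₀ := by
      filter_upwards [hUo.mem_nhds hθ] with y hy using hU y hy
    rw [hloc.deriv_eq, deriv_const]
  have h0 : deriv (deriv h) θ₀ = 0 := by rw [hderiv.deriv_eq, deriv_const]
  exact absurd h0 hpos.ne'

/-- **A supporting functional of the body at a point of the Fermi curve is a positive multiple of
`⟨∇e, ·⟩`** ([II] p.7 L63: "let `n = ∇e/|∇e|` be the unit normal to `S`", for the convex body bounded by
`S`, with the orientation of (A3)/(frene), p.8 L125–126). Planar geometry: `C` a compact convex body with
interior, `e ∈ C²` with `∂C ⊆ {e = 0}`, `∇e ≠ 0` on `∂C` and `(v, e''(x) v) > 0` for non-zero tangent `v`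
at the points of `∂C`; if a non-zero functional `f` attains its maximum over `C` at `x ∈ ∂C`, then
`f = μ ⟨∇e(x), ·⟩` with `μ > 0`. (Along the `C²` constant-speed boundary curve `γ` through `x`,
maximality gives `f(γ') = 0` and `f(γ'') ≤ 0`; in the plane `f = μ ⟨∇e(x), ·⟩` as both kill `γ' ≠ 0`;
(Trick) `(γ', e''γ') = -⟨∇e, γ''⟩ > 0` fixes the sign of `μ`.) No filling condition (A5) is needed.
[cite: FeldmanSalmhoferTrubowitz1998, §2.1 (arXiv p.7 L58–66) with eq. (frene) (p.8 L117–126)] -/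
theorem exists_pos_eq_mul_inner_gradient_of_isMaxOn (hd : Module.finrank ℝ E = 2) {C : Set E}
    (hC : IsCompact C) (hconv : Convex ℝ C) (hint : (interior C).Nonempty) {e : E → ℝ}
    (he : ContDiff ℝ 2 e) (hzero : ∀ p ∈ frontier C, e p = 0)
    (hgrad : ∀ p ∈ frontier C, gradient e p ≠ 0)
    (hcurv : ∀ p ∈ frontier C, ∀ v : E, v ≠ 0 → inner ℝ (gradient e p) v = 0 → 0 < hessQuad e p v)
    {x : E} (hx : x ∈ frontier C) {f : E →L[ℝ] ℝ} (hf0 : f ≠ 0) (hfle : ∀ y ∈ C, f y ≤ f x) :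
    ∃ μ : ℝ, 0 < μ ∧ ∀ z, f z = μ * inner ℝ (gradient e x) z := by
  haveI : FiniteDimensional ℝ E := Module.finite_of_finrank_eq_succ hd
  -- the `C²` constant-speed parametrisation of `∂C`, through `x = γ θ₀`
  obtain ⟨γ, dγ, P, hP, -, hmem, hsurj, -, hder, hnorm, -, hC2⟩ :=
    exists_contDiff_constSpeed_param_frontier hd hC hconv hint (k := 2) (by norm_num)
      (by exact_mod_cast he) hzero hgrad
  obtain ⟨θ₀, -, rfl⟩ := hsurj hx
  have hC2' : ContDiff ℝ 2 γ := by exact_mod_cast hC2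
  have hdγ_eq : deriv γ = dγ := funext fun t => (hder t).deriv
  have hdγC : ContDiff ℝ 1 dγ := by
    rw [← hdγ_eq]
    rw [show (2 : WithTop ℕ∞) = 1 + 1 by norm_num, contDiff_succ_iff_deriv] at hC2'
    exact hC2'.2.2
  have hdγd : ∀ t, HasDerivAt dγ (deriv dγ t) t := fun t =>
    ((hdγC.differentiable one_ne_zero) t).hasDerivAt
  set ddγ : E := deriv dγ θ₀ with hddγ
  have hzero' : ∀ t, e (γ t) = 0 := fun t => hzero _ (hmem t)
  have hγC : ∀ t, γ t ∈ C := fun t =>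
    hC.isClosed.closure_subset (frontier_subset_closure (hmem t))
  -- `h t = f (γ t)` is maximal at `θ₀`
  have hh : ∀ t, HasDerivAt (fun t => f (γ t)) (f (dγ t)) t := fun t =>
    f.hasFDerivAt.comp_hasDerivAt t (hder t)
  have hh' : deriv (fun t => f (γ t)) = fun t => f (dγ t) := funext fun t => (hh t).deriv
  have hh2 : HasDerivAt (fun t => f (dγ t)) (f ddγ) θ₀ :=
    f.hasFDerivAt.comp_hasDerivAt θ₀ (hdγd θ₀)
  have hmax : ∀ t, f (γ t) ≤ f (γ θ₀) := fun t => hfle _ (hγC t)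
  -- first order: `f (γ' θ₀) = 0`
  have hfd0 : f (dγ θ₀) = 0 := by
    have hlm : IsLocalMax (fun t => f (γ t)) θ₀ := Filter.Eventually.of_forall hmax
    exact hlm.hasDerivAt_eq_zero (hh θ₀)
  -- second order: `f (γ'' θ₀) ≤ 0`
  have hfdd : f ddγ ≤ 0 := by
    have h1 := deriv_deriv_nonpos_of_forall_le hmax (hh θ₀).continuousAt
      (by rw [hh']; exact hfd0)
    rwa [hh', hh2.deriv] at h1
  -- the Riesz vector of `f` is a multiple of `∇e (γ θ₀)` (both are orthogonal to `γ' θ₀ ≠ 0`)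
  set wf : E := (InnerProductSpace.toDual ℝ E).symm f with hwf
  have hwf_inner : ∀ z, inner ℝ wf z = f z := fun z => InnerProductSpace.toDual_symm_apply
  have hwf0 : wf ≠ 0 := by
    intro h0
    apply hf0
    ext z
    rw [← hwf_inner, h0, inner_zero_left, zero_apply]
  have hv0 : dγ θ₀ ≠ 0 := by
    intro h0
    have h1 := hnorm θ₀
    rw [h0, norm_zero] at h1
    exact (inv_pos.2 hP).ne h1
  have hgv : inner ℝ (gradient e (γ θ₀)) (dγ θ₀) = 0 :=
    inner_gradient_eq_zero_of_apply_comp_eq_zero ((he.differentiable (by norm_num)) _) (hder θ₀)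
      hzero'
  have hwv : inner ℝ wf (dγ θ₀) = 0 := by rw [hwf_inner]; exact hfd0
  obtain ⟨μ, hμ⟩ :=
    exists_smul_of_inner_eq_zero_of_finrank_eq_two hd hv0 (hgrad _ (hmem θ₀)) hwv hgv
  -- (Trick) and the curvature sign give `μ > 0`
  have htrick := hessQuad_add_inner_gradient_eq_zero he hder (hdγd θ₀) hzero'
  have hpos : 0 < hessQuad e (γ θ₀) (dγ θ₀) := hcurv _ (hmem θ₀) _ hv0 hgv
  have hfμ : ∀ z, f z = μ * inner ℝ (gradient e (γ θ₀)) z := fun z => by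
    rw [← hwf_inner, hμ, real_inner_smul_left]
  have hμ0 : μ ≠ 0 := by
    rintro rfl
    rw [zero_smul] at hμ
    exact hwf0 hμ
  refine ⟨μ, ?_, hfμ⟩
  rcases lt_or_gt_of_ne hμ0 with hneg | hpos'
  · exfalso
    have h1 : inner ℝ (gradient e (γ θ₀)) ddγ = -hessQuad e (γ θ₀) (dγ θ₀) := by linarith
    have h2 : f ddγ = μ * -hessQuad e (γ θ₀) (dγ θ₀) := by rw [hfμ, h1]
    have h3 : 0 < f ddγ := by rw [h2]; nlinarith
    linarith
  · exact hpos'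

/-- **`∇e` is the outward normal of the body bounded by the Fermi curve** — the orientation half of
(A3) ([II] p.7 L58–62: "`κ` is strictly positive everywhere … (A3) implies that `S` bounds a strictly
convex set"; (frene) p.8 L125–126: "the sign is `-1` if `e(p) < 0` inside `S`"; [III §1 (3)]). Planar
geometry: let `C` be a compact convex body with interior, `e ∈ C²` with `∂C ⊆ {e = 0}`, `∇e ≠ 0` on
`∂C`, and `(v, e''(x) v) > 0` for non-zero tangent `v` at every `x ∈ ∂C` (the local half `HypA3`,
oriented so that `{e < 0}` is the convex side). Then at every `x ∈ ∂C`, `∇e(x)` is an OUTWARD normal: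
`⟨∇e(x), y - x⟩ ≤ 0` for all `y ∈ C` (a supporting functional at `x` exists by Hahn–Banach and is a
positive multiple of `⟨∇e(x), ·⟩`, `exists_pos_eq_mul_inner_gradient_of_isMaxOn`). No filling
condition (A5) is needed.
[cite: FeldmanSalmhoferTrubowitz1998, Assumption A3 (arXiv p.7 L58–62) with eq. (frene) (p.8 L117–126)] -/
theorem inner_gradient_sub_nonpos_of_hessQuad_pos (hd : Module.finrank ℝ E = 2) {C : Set E}
    (hC : IsCompact C) (hconv : Convex ℝ C) (hint : (interior C).Nonempty) {e : E → ℝ}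
    (he : ContDiff ℝ 2 e) (hzero : ∀ p ∈ frontier C, e p = 0)
    (hgrad : ∀ p ∈ frontier C, gradient e p ≠ 0)
    (hcurv : ∀ p ∈ frontier C, ∀ v : E, v ≠ 0 → inner ℝ (gradient e p) v = 0 → 0 < hessQuad e p v)
    {x : E} (hx : x ∈ frontier C) {y : E} (hy : y ∈ C) : inner ℝ (gradient e x) (y - x) ≤ 0 := by
  have hxi : x ∉ interior C := by
    have h1 := hx
    rw [frontier, Set.mem_sdiff] at h1
    exact h1.2
  obtain ⟨f, hf0, hfle⟩ := geometric_hahn_banach_of_nonempty_interior_point hconv hxi hint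
  obtain ⟨μ, hμ, hfμ⟩ :=
    exists_pos_eq_mul_inner_gradient_of_isMaxOn hd hC hconv hint he hzero hgrad hcurv hx hf0 hfle
  have h1 : f (y - x) ≤ 0 := by
    rw [map_sub, sub_nonpos]
    exact hfle y hy
  rw [hfμ] at h1
  rcases mul_nonpos_iff.1 h1 with ⟨_, h2⟩ | ⟨h2, _⟩
  · exact h2
  · exact absurd h2 (not_le.2 hμ)

/-- Consequently `⟨∇e(x), c - x⟩ < 0` strictly for INTERIOR points `c` of the body: `e` decreases from
`x ∈ S` into the Fermi sea ("`e < 0` inside `S`", (frene) p.8 L125–126).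
[cite: FeldmanSalmhoferTrubowitz1998, Assumption A3 (arXiv p.7 L58–62) with eq. (frene) (p.8 L125–126)] -/
theorem inner_gradient_sub_neg_of_mem_interior (hd : Module.finrank ℝ E = 2) {C : Set E}
    (hC : IsCompact C) (hconv : Convex ℝ C) {e : E → ℝ} (he : ContDiff ℝ 2 e)
    (hzero : ∀ p ∈ frontier C, e p = 0) (hgrad : ∀ p ∈ frontier C, gradient e p ≠ 0)
    (hcurv : ∀ p ∈ frontier C, ∀ v : E, v ≠ 0 → inner ℝ (gradient e p) v = 0 → 0 < hessQuad e p v)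
    {x : E} (hx : x ∈ frontier C) {c : E} (hc : c ∈ interior C) :
    inner ℝ (gradient e x) (c - x) < 0 := by
  obtain ⟨ε, hε, hball⟩ := Metric.isOpen_iff.1 isOpen_interior c hc
  set g : E := gradient e x with hg
  have hg0 : g ≠ 0 := hgrad x hx
  have hgn : 0 < ‖g‖ := norm_pos_iff.2 hg0
  set t : ℝ := ε / (2 * ‖g‖) with ht
  have htpos : 0 < t := by positivity
  have hmem : c + t • g ∈ C := by
    refine interior_subset (hball ?_)
    rw [Metric.mem_ball, dist_eq_norm, add_sub_cancel_left, norm_smul, Real.norm_eq_abs,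
      abs_of_pos htpos, ht, div_mul_eq_mul_div, mul_comm ε, mul_div_assoc]
    have : ‖g‖ * (ε / (2 * ‖g‖)) = ε / 2 := by field_simp
    rw [this]
    linarith
  have h1 := inner_gradient_sub_nonpos_of_hessQuad_pos hd hC hconv ⟨c, hc⟩ he hzero hgrad hcurv hx hmem
  have h2 : inner ℝ g (c + t • g - x) = inner ℝ g (c - x) + t * ‖g‖ ^ 2 := by
    rw [show c + t • g - x = (c - x) + t • g by abel, inner_add_right, real_inner_smul_right,
      real_inner_self_eq_norm_sq]
  rw [h2] at h1
  nlinarith [pow_pos hgn 2]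

/-- **Orientation under (A2), (A3), `d = 2`, in the tree's vocabulary.** If `e` satisfies (A2)_{k,h} with
`k ≥ 2` and the local curvature half `HypA3` of (A3), and `S ∩ F = ∂C` for a compact convex body `C`
with interior (the data of the global half `HypA3Global`), then `∇e` points OUT of `C` along `S ∩ F`:
`⟨∇e(x), y - x⟩ ≤ 0` for `x ∈ S ∩ F`, `y ∈ C` — i.e. the Fermi sea `C` lies on the side `{e < 0}` of its
boundary, the orientation in which [II] fixes the sign of (frene) ("`-1` if `e < 0` inside `S`").
[cite: FeldmanSalmhoferTrubowitz1998, Assumption A3 (arXiv p.7 L58–62) with eq. (frene) (p.8 L117–126)] -/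
theorem HypA3.inner_gradient_sub_nonpos (hd : Module.finrank ℝ E = 2) {cr : Crystal E} {e : E → ℝ}
    {k : ℕ} {h : ℝ≥0} (hk : 2 ≤ k) (hA2 : HypA2 cr k h e) (hA3 : HypA3 e) {C : Set E}
    (hC : IsCompact C) (hconv : Convex ℝ C) (hint : (interior C).Nonempty)
    (hSF : cr.fermiSurfaceRep e = frontier C) {x : E} (hx : x ∈ cr.fermiSurfaceRep e) {y : E}
    (hy : y ∈ C) : inner ℝ (gradient e x) (y - x) ≤ 0 := by
  have he : ContDiff ℝ 2 e := hA2.memContDiffHolder.contDiff.of_le (by exact_mod_cast hk)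
  have hS : ∀ p ∈ frontier C, p ∈ fermiSurface e := fun p hp => by
    rw [← hSF] at hp
    exact hp.1
  exact inner_gradient_sub_nonpos_of_hessQuad_pos hd hC hconv hint he (fun p hp => hS p hp)
    (fun p hp => hA2.gradient_ne_zero p (hS p hp)) (fun p hp => hA3 p (hS p hp)) (hSF ▸ hx) hy

/-! ### The antipode in `d = 2` [II p.7 L60–66] -/

/-- A non-zero functional on a set with non-empty interior does not attain its maximum over the set at
an interior point. [folklore] -/
private theorem not_mem_interior_of_isMaxOn {C : Set E} {f : E →L[ℝ] ℝ} (hf0 : f ≠ 0) {q : E}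
    (hfle : ∀ y ∈ C, f y ≤ f q) : q ∉ interior C := by
  intro hq
  set w : E := (InnerProductSpace.toDual ℝ E).symm f with hw
  have hw_inner : ∀ z, inner ℝ w z = f z := fun z => InnerProductSpace.toDual_symm_apply
  have hw0 : w ≠ 0 := by
    intro h0
    apply hf0
    ext z
    rw [← hw_inner, h0, inner_zero_left, zero_apply]
  obtain ⟨ε, hε, hball⟩ := Metric.isOpen_iff.1 isOpen_interior q hq
  have hwn : 0 < ‖w‖ := norm_pos_iff.2 hw0
  set t : ℝ := ε / (2 * ‖w‖) with ht
  have htpos : 0 < t := by positivity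
  have hmem : q + t • w ∈ C := by
    refine interior_subset (hball ?_)
    rw [Metric.mem_ball, dist_eq_norm, add_sub_cancel_left, norm_smul, Real.norm_eq_abs,
      abs_of_pos htpos, ht]
    have : ε / (2 * ‖w‖) * ‖w‖ = ε / 2 := by field_simp
    rw [this]
    linarith
  have h1 := hfle _ hmem
  rw [map_add, map_smul, smul_eq_mul, ← hw_inner w, real_inner_self_eq_norm_sq] at h1
  nlinarith [pow_pos hwn 2]

/-- **Existence of the antipode in `d = 2`** ([II] p.7 L60–66: "Let `n = ∇e/|∇e|` be the unit normal to
`S`. Strict convexity implies that the equation `n(a(p)) = -n(p)` has, for any `p ∈ S`, a unique solution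
`a(p) ∈ S`"). Planar-geometry form: for the body `C` of the orientation theorem and `p ∈ ∂C` there is
`q ∈ ∂C` with `n(q) = -n(p)` — the support point of `C` in the direction `-n(p)` (a maximiser of
`⟨-n(p), ·⟩` over the compact `C`; it lies on `∂C`, and there the functional is a positive multiple of
`⟨∇e(q), ·⟩` by `exists_pos_eq_mul_inner_gradient_of_isMaxOn`). Convexity suffices for existence.
[cite: FeldmanSalmhoferTrubowitz1998, §2.1 (arXiv p.7 L60–66)] -/
theorem exists_isAntipode_of_hessQuad_pos (hd : Module.finrank ℝ E = 2) {C : Set E} (hC : IsCompact C)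
    (hconv : Convex ℝ C) (hint : (interior C).Nonempty) {e : E → ℝ} (he : ContDiff ℝ 2 e)
    (hzero : ∀ p ∈ frontier C, e p = 0) (hgrad : ∀ p ∈ frontier C, gradient e p ≠ 0)
    (hcurv : ∀ p ∈ frontier C, ∀ v : E, v ≠ 0 → inner ℝ (gradient e p) v = 0 → 0 < hessQuad e p v)
    {p : E} (hp : p ∈ frontier C) : ∃ q ∈ frontier C, IsAntipode e p q := by
  set N : E := unitNormal e p with hN
  have hgp : gradient e p ≠ 0 := hgrad p hp
  have hN1 : ‖N‖ = 1 := by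
    rw [hN, unitNormal, norm_smul, norm_inv, norm_norm, inv_mul_cancel₀ (norm_ne_zero_iff.2 hgp)]
  have hN0 : N ≠ 0 := by
    intro h0; rw [h0, norm_zero] at hN1; exact zero_ne_one hN1
  -- the functional `⟨-N, ·⟩` and a maximiser `q` over `C`
  set f : E →L[ℝ] ℝ := InnerProductSpace.toDual ℝ E (-N) with hf
  have hf_apply : ∀ z, f z = inner ℝ (-N) z := fun z => InnerProductSpace.toDual_apply_apply
  have hf0 : f ≠ 0 := by
    intro h0
    have h1 : f (-N) = 0 := by rw [h0, zero_apply]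
    rw [hf_apply, real_inner_self_eq_norm_sq, norm_neg, hN1] at h1
    norm_num at h1
  have hCne : C.Nonempty := hint.mono interior_subset
  obtain ⟨q, hqC, hqmax⟩ := hC.exists_isMaxOn hCne f.continuous.continuousOn
  have hfle : ∀ y ∈ C, f y ≤ f q := fun y hy => hqmax hy
  have hq : q ∈ frontier C := by
    rw [frontier, Set.mem_sdiff]
    exact ⟨subset_closure hqC, not_mem_interior_of_isMaxOn hf0 hfle⟩
  obtain ⟨μ, hμ, hfμ⟩ :=
    exists_pos_eq_mul_inner_gradient_of_isMaxOn hd hC hconv hint he hzero hgrad hcurv hq hf0 hfle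
  -- `-N = μ ∇e(q)`, hence `n(q) = -N`
  have hNq : -N = μ • gradient e q := by
    have h1 : ∀ z, inner ℝ (-N - μ • gradient e q) z = 0 := fun z => by
      rw [inner_sub_left, real_inner_smul_left, ← hf_apply, hfμ z, sub_self]
    have h2 := h1 (-N - μ • gradient e q)
    rw [real_inner_self_eq_norm_sq, sq_eq_zero_iff, norm_eq_zero, sub_eq_zero] at h2
    exact h2
  have hgq : gradient e q = (-μ⁻¹) • N := by
    have h1 : μ • gradient e q = -N := hNq.symm
    calc gradient e q = μ⁻¹ • (μ • gradient e q) := by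
          rw [smul_smul, inv_mul_cancel₀ hμ.ne', one_smul]
      _ = μ⁻¹ • (-N) := by rw [h1]
      _ = (-μ⁻¹) • N := by rw [smul_neg, neg_smul]
  have hnq : ‖gradient e q‖ = μ⁻¹ := by
    rw [hgq, norm_smul, Real.norm_eq_abs, abs_neg, abs_of_pos (inv_pos.2 hμ), hN1, mul_one]
  refine ⟨q, hq, hzero p hp, hzero q hq, ?_⟩
  show unitNormal e q = -unitNormal e p
  rw [unitNormal, hnq, hgq, inv_inv, smul_smul, mul_neg, mul_inv_cancel₀ hμ.ne', neg_one_smul]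

/-- **Uniqueness of the antipode in `d = 2`** ([II] p.7 L60–66: "… has, for any `p ∈ S`, a unique solution
`a(p) ∈ S`"): for the STRICTLY convex body `C` of the orientation theorem, two points of `∂C` with the
same unit normal coincide — so `n(q) = -n(p) = n(q')` forces `q = q'`. (Both are support points of the
same outward direction; the midpoint of two distinct ones would be an interior point on the supporting
line, contradicting `inner_gradient_sub_neg_of_mem_interior`.) No filling condition (A5) is needed.
[cite: FeldmanSalmhoferTrubowitz1998, §2.1 (arXiv p.7 L60–66)] -/
theorem eq_of_isAntipode_of_isAntipode (hd : Module.finrank ℝ E = 2) {C : Set E} (hC : IsCompact C)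
    (hsc : StrictConvex ℝ C) (hint : (interior C).Nonempty) {e : E → ℝ} (he : ContDiff ℝ 2 e)
    (hzero : ∀ p ∈ frontier C, e p = 0) (hgrad : ∀ p ∈ frontier C, gradient e p ≠ 0)
    (hcurv : ∀ p ∈ frontier C, ∀ v : E, v ≠ 0 → inner ℝ (gradient e p) v = 0 → 0 < hessQuad e p v)
    {p q q' : E} (hq : q ∈ frontier C) (hq' : q' ∈ frontier C) (h : IsAntipode e p q)
    (h' : IsAntipode e p q') : q = q' := by
  by_contra hne
  have hconv : Convex ℝ C := hsc.convex
  have hsubC : frontier C ⊆ C := frontier_subset_closure.trans hC.isClosed.closure_subset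
  set N : E := -unitNormal e p with hN
  have hnq : unitNormal e q = N := h.2.2
  have hnq' : unitNormal e q' = N := h'.2.2
  -- `∇e = ‖∇e‖ • N` at `q` and at `q'`
  have hdecomp : ∀ {z : E}, z ∈ frontier C → unitNormal e z = N →
      gradient e z = ‖gradient e z‖ • N := by
    intro z hz hnz
    rw [← hnz, unitNormal, smul_smul, mul_inv_cancel₀ (norm_ne_zero_iff.2 (hgrad z hz)), one_smul]
  -- the outward-normal inequalities, divided by `‖∇e‖ > 0`
  have hle : ∀ {z : E}, z ∈ frontier C → unitNormal e z = N → ∀ y ∈ C, inner ℝ N (y - z) ≤ 0 := by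
    intro z hz hnz y hy
    have h1 := inner_gradient_sub_nonpos_of_hessQuad_pos hd hC hconv hint he hzero hgrad hcurv hz hy
    rw [hdecomp hz hnz, real_inner_smul_left] at h1
    have hpos : 0 < ‖gradient e z‖ := norm_pos_iff.2 (hgrad z hz)
    rcases mul_nonpos_iff.1 h1 with ⟨_, h2⟩ | ⟨h2, _⟩
    · exact h2
    · exact absurd h2 (not_le.2 hpos)
  have h1 : inner ℝ N (q' - q) ≤ 0 := hle hq hnq q' (hsubC hq')
  have h2 : inner ℝ N (q - q') ≤ 0 := hle hq' hnq' q (hsubC hq)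
  have h3 : inner ℝ N (q' - q) = 0 := by
    have : inner ℝ N (q - q') = -inner ℝ N (q' - q) := by rw [← inner_neg_right, neg_sub]
    linarith
  -- the midpoint is interior (strict convexity) but lies on the supporting line at `q`
  set m : E := (1 / 2 : ℝ) • q + (1 / 2 : ℝ) • q' with hm
  have hmi : m ∈ interior C :=
    hsc (hsubC hq) (hsubC hq') hne (by norm_num) (by norm_num) (by norm_num)
  have h4 := inner_gradient_sub_neg_of_mem_interior hd hC hconv he hzero hgrad hcurv hq hmi
  rw [hdecomp hq hnq, real_inner_smul_left] at h4
  have h5 : inner ℝ N (m - q) = 0 := by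
    have : m - q = (1 / 2 : ℝ) • (q' - q) := by rw [hm]; module
    rw [this, real_inner_smul_right, h3, mul_zero]
  rw [h5, mul_zero] at h4
  exact lt_irrefl _ h4

/-- **The antipodal map exists under (A2), (A3), `d = 2`, in the tree's vocabulary** ([II] p.7 L60–66):
(A2)_{k,h} with `k ≥ 2`, the local half `HypA3` and the global half `HypA3Global` of (A3) and
`finrank ℝ E = 2` give an antipodal map `a` of `S ∩ F` (`IsAntipodalMapOn`: `a(p) ∈ S ∩ F`,
`n(a(p)) = -n(p)`) — so the existential `∃ a` over which (A4) (`HypA4`) is typed is inhabited; with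
`eq_of_isAntipode_of_isAntipode` it is unique. No filling condition (A5) is needed.
[cite: FeldmanSalmhoferTrubowitz1998, §2.1 (arXiv p.7 L60–66)] -/
theorem exists_isAntipodalMapOn (hd : Module.finrank ℝ E = 2) {cr : Crystal E} {e : E → ℝ} {k : ℕ}
    {h : ℝ≥0} (hk : 2 ≤ k) (hA2 : HypA2 cr k h e) (hA3 : HypA3 e) (hG : HypA3Global cr e) :
    ∃ a : E → E, IsAntipodalMapOn e (cr.fermiSurfaceRep e) a := by
  obtain ⟨C, hC, hsc, hint, hSF⟩ := hG
  have he : ContDiff ℝ 2 e := hA2.memContDiffHolder.contDiff.of_le (by exact_mod_cast hk)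
  have hS : ∀ p ∈ frontier C, p ∈ fermiSurface e := fun p hp => by
    rw [← hSF] at hp
    exact hp.1
  have key : ∀ p ∈ cr.fermiSurfaceRep e, ∃ q ∈ cr.fermiSurfaceRep e, IsAntipode e p q := by
    intro p hp
    rw [hSF] at hp ⊢
    exact exists_isAntipode_of_hessQuad_pos hd hC hsc.convex hint he (fun p hp => hS p hp)
      (fun p hp => hA2.gradient_ne_zero p (hS p hp)) (fun p hp => hA3 p (hS p hp)) hp
  classical
  refine ⟨fun p => if hp : p ∈ cr.fermiSurfaceRep e then (key p hp).choose else p, fun p hp => ?_⟩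
  simp only [dif_pos hp]
  exact (key p hp).choose_spec


/-- **The antipodal map is an involution**, `a(a(p)) = p`, in `d = 2` under (A2)_{k,h} (`k ≥ 2`) and both
halves of (A3) — uniqueness of the antipode ([II] p.7 L60–66) applied to `n(a(a(p))) = -n(a(p)) = n(p)`;
the tree's `IsAntipodalMapOn.apply_apply` (`FST2FindCPProof`) proves the same in every dimension but
under the filling condition (A5), which is not needed here.
[cite: FeldmanSalmhoferTrubowitz1998, §2.1 (arXiv p.7 L60–66)] -/
theorem IsAntipodalMapOn.apply_apply_of_finrank_eq_two (hd : Module.finrank ℝ E = 2) {cr : Crystal E}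
    {e : E → ℝ} {k : ℕ} {h : ℝ≥0} (hk : 2 ≤ k) (hA2 : HypA2 cr k h e) (hA3 : HypA3 e)
    (hG : HypA3Global cr e) {a : E → E} (ha : IsAntipodalMapOn e (cr.fermiSurfaceRep e) a) {x : E}
    (hx : x ∈ cr.fermiSurfaceRep e) : a (a x) = x := by
  obtain ⟨C, hC, hsc, hint, hSF⟩ := hG
  have he : ContDiff ℝ 2 e := hA2.memContDiffHolder.contDiff.of_le (by exact_mod_cast hk)
  have hS : ∀ p ∈ frontier C, p ∈ fermiSurface e := fun p hp => by
    rw [← hSF] at hp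
    exact hp.1
  have hax : a x ∈ cr.fermiSurfaceRep e := (ha x hx).1
  have haax : a (a x) ∈ cr.fermiSurfaceRep e := (ha (a x) hax).1
  -- both `a (a x)` and `x` are antipodes of `a x`
  have h1 : IsAntipode e (a x) (a (a x)) := (ha (a x) hax).2
  have h2 : IsAntipode e (a x) x := by
    refine ⟨hax.1, hx.1, ?_⟩
    rw [(ha x hx).2.2.2, neg_neg]
  exact eq_of_isAntipode_of_isAntipode hd hC hsc hint he (fun p hp => hS p hp)
    (fun p hp => hA2.gradient_ne_zero p (hS p hp)) (fun p hp => hA3 p (hS p hp))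
    (hSF ▸ haax) (hSF ▸ hx) h1 h2

/-! ### (curvratio): the derivative of the antipode along the angular coordinate [II p.9 L80–104] -/

/-- [II] §2.2, eqs. (antidef)–(deltwop)–(curvratio) · p.9 L80–104: "`∂_θ p(0,a(θ)) = -∂_θ p(0,θ)` …
`∂²_θ p(0,a(θ)) ∂a/∂θ = -∂²_θ p(0,θ)` … by choice of the coordinate `θ`, `∂²_θ p(0,θ) ∝ n(p(0,θ))`, so
`∂a/∂θ = |∂²_θ p(0,θ)|/|∂²_θ p(0,a(θ))| = κ(0,θ)/κ(0,a(θ))`. Thus (A4) is simply a condition on the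
ratio of the curvatures at `p` and its antipode." Typed coordinate-free, WITHOUT assuming the angular
antipode `θ ↦ a(θ)` differentiable as a function of `θ`: for an antipodal map `a` of `S ∩ F`, at any
`θ` where `t ↦ a(p(0,t))` is differentiable with derivative `b` (the quantity (A4) = `HypA4` speaks
about) and `∂_θ p` is differentiable, `|b| = (κ(p)/κ(a(p))) |∂_θ p(0,θ)|`, i.e. the (A4) quantity
`|∂_θ p|⁻¹ |∂_θ(a ∘ p)|` IS the tree's `antipodeAngularDeriv e a Θ θ` of (A4′). Hypotheses: `d = 2`,
(A2)_{k,h} with `k ≥ 2`, the local half `HypA3` of (A3) (curvatures non-zero). (Proof: `b ⊥ ∇e(a p)`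
and `∂_θ p ⊥ ∇e(p) ∥ ∇e(a p)` make `b = λ ∂_θ p` in the plane; differentiating
`⟨∇e(a(p(0,t))), ∂_θ p(0,t)⟩ ≡ 0` and (Trick) give `λ w(a p) = -(|∇e(a p)|/|∇e(p)|) w(p)`.)
[cite: FeldmanSalmhoferTrubowitz1998, §2.2 eq. (curvratio) (arXiv p.9 L80–104)] -/
theorem FermiCurveParam.norm_deriv_antipode_eq (hd : Module.finrank ℝ E = 2) {cr : Crystal E}
    {e : E → ℝ} {k : ℕ} {h : ℝ≥0} (hk : 2 ≤ k) (hA2 : HypA2 cr k h e) (hA3 : HypA3 e)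
    (Θ : FermiCurveParam cr e) {a : E → E} (ha : IsAntipodalMapOn e (cr.fermiSurfaceRep e) a) {θ : ℝ}
    (hdγ : DifferentiableAt ℝ Θ.dγ θ) {b : E} (hb : HasDerivAt (fun t => a (Θ.γ t)) b θ) :
    ‖b‖ = antipodeAngularDeriv e a Θ θ * ‖Θ.dγ θ‖ := by
  have he : ContDiff ℝ 2 e := hA2.memContDiffHolder.contDiff.of_le (by exact_mod_cast hk)
  have hdiff : Differentiable ℝ e := he.differentiable (by norm_num)
  have hzero : ∀ t, e (Θ.γ t) = 0 := fun t => (Θ.mem t).1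
  have hmemA : ∀ t, a (Θ.γ t) ∈ cr.fermiSurfaceRep e := fun t => (ha _ (Θ.mem t)).1
  have hzeroA : ∀ t, e (a (Θ.γ t)) = 0 := fun t => (hmemA t).1
  have hgp : ∀ t, gradient e (Θ.γ t) ≠ 0 := fun t => hA2.gradient_ne_zero _ (Θ.mem t).1
  have hgq : ∀ t, gradient e (a (Θ.γ t)) ≠ 0 := fun t => hA2.gradient_ne_zero _ (hmemA t).1
  -- antiparallel normals: `∇e (a p) = -(‖∇e (a p)‖/‖∇e p‖) • ∇e p`
  have hanti : ∀ t, gradient e (a (Θ.γ t)) =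
      -(‖gradient e (a (Θ.γ t))‖ * ‖gradient e (Θ.γ t)‖⁻¹) • gradient e (Θ.γ t) := by
    intro t
    have h1 : unitNormal e (a (Θ.γ t)) = -unitNormal e (Θ.γ t) := (ha _ (Θ.mem t)).2.2.2
    unfold unitNormal at h1
    have hn : ‖gradient e (a (Θ.γ t))‖ ≠ 0 := norm_ne_zero_iff.2 (hgq t)
    calc gradient e (a (Θ.γ t))
        = ‖gradient e (a (Θ.γ t))‖ • (‖gradient e (a (Θ.γ t))‖⁻¹ • gradient e (a (Θ.γ t))) := by
          rw [smul_smul, mul_inv_cancel₀ hn, one_smul]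
      _ = -(‖gradient e (a (Θ.γ t))‖ * ‖gradient e (Θ.γ t)‖⁻¹) • gradient e (Θ.γ t) := by
          rw [h1, smul_neg, smul_smul, neg_smul]
  -- tangency: `⟨∇e p, ∂_θ p⟩ = 0`, hence `⟨∇e (a p), ∂_θ p⟩ = 0`, for all `t`
  have hpv : ∀ t, inner ℝ (gradient e (Θ.γ t)) (Θ.dγ t) = 0 := fun t =>
    inner_gradient_eq_zero_of_apply_comp_eq_zero (hdiff _) (Θ.hasDerivAt t) hzero
  have hqv : ∀ t, inner ℝ (gradient e (a (Θ.γ t))) (Θ.dγ t) = 0 := fun t => by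
    rw [hanti t, real_inner_smul_left, hpv t, mul_zero]
  -- notation at `θ`
  set p : E := Θ.γ θ with hp
  set q : E := a (Θ.γ θ) with hq
  set v : E := Θ.dγ θ with hv
  set r : ℝ := ‖gradient e q‖ * ‖gradient e p‖⁻¹ with hr
  have hrpos : 0 < r := mul_pos (norm_pos_iff.2 (hgq θ)) (inv_pos.2 (norm_pos_iff.2 (hgp θ)))
  have hv0 : v ≠ 0 := by
    intro h0
    have h1 := Θ.norm_dγ θ
    rw [← hv, h0, norm_zero] at h1
    exact (inv_pos.2 Θ.P_pos).ne h1
  -- `b ⊥ ∇e q` (the curve `t ↦ a (p(0,t))` stays in `S`), so `b = λ • v` in the plane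
  have hqb : inner ℝ (gradient e q) b = 0 :=
    inner_gradient_eq_zero_of_apply_comp_eq_zero (γ := fun t => a (Θ.γ t)) (hdiff _) hb hzeroA
  obtain ⟨lam, hlam⟩ := exists_smul_of_inner_eq_zero_of_finrank_eq_two hd (hgq θ) hv0
    (by rw [real_inner_comm]; exact hqb) (by rw [real_inner_comm]; exact hqv θ)
  -- differentiate `t ↦ ⟨∇e (a p(0,t)), ∂_θ p(0,t)⟩ ≡ 0` at `θ`
  set ddγ : E := deriv Θ.dγ θ with hddγ
  have hdd : HasDerivAt Θ.dγ ddγ θ := hdγ.hasDerivAt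
  have hfd : DifferentiableAt ℝ (fderiv ℝ e) q :=
    ((he.fderiv_right (m := 1) le_rfl).differentiable one_ne_zero) q
  have hc : HasDerivAt (fun t => fderiv ℝ e (a (Θ.γ t))) (fderiv ℝ (fderiv ℝ e) q b) θ :=
    hfd.hasFDerivAt.comp_hasDerivAt θ hb
  have hG : HasDerivAt (fun t => fderiv ℝ e (a (Θ.γ t)) (Θ.dγ t))
      (fderiv ℝ (fderiv ℝ e) q b v + fderiv ℝ e q ddγ) θ := hc.clm_apply hdd
  have hG' : HasDerivAt (fun t => fderiv ℝ e (a (Θ.γ t)) (Θ.dγ t)) 0 θ := by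
    have h0 : (fun t => fderiv ℝ e (a (Θ.γ t)) (Θ.dγ t)) = fun _ => (0 : ℝ) := by
      funext t
      rw [← inner_gradient_left]
      exact hqv t
    rw [h0]
    exact hasDerivAt_const θ 0
  have key := hG.unique hG'
  -- rewrite the two terms: `λ w(q)` and `⟨∇e q, ∂²_θ p⟩ = r w(p)` ((Trick) at `p`)
  have hterm1 : fderiv ℝ (fderiv ℝ e) q b v = lam * hessQuad e q v := by
    rw [hlam, map_smul, smul_apply, smul_eq_mul]
    unfold hessQuad
    rw [iteratedFDeriv_two_apply]
    simp
  have htrickp := hessQuad_add_inner_gradient_eq_zero he Θ.hasDerivAt hdd hzero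
  have hterm2 : fderiv ℝ e q ddγ = r * hessQuad e p v := by
    rw [← inner_gradient_left, hanti θ, real_inner_smul_left]
    have h1 : inner ℝ (gradient e p) ddγ = -hessQuad e p v := by
      rw [hp, hv]; linarith
    rw [h1, hr]
    ring
  rw [hterm1, hterm2] at key
  -- curvatures at `p` and `q = a p` (unit tangent `P • v` at both)
  have hposp : 0 < hessQuad e p v := hA3 p (Θ.mem θ).1 v hv0 (hpv θ)
  have hposq : 0 < hessQuad e q v := hA3 q (hmemA θ).1 v hv0 (hqv θ)
  have ht1 : ‖Θ.P • v‖ = 1 := by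
    rw [norm_smul, Real.norm_eq_abs, abs_of_pos Θ.P_pos, hv, Θ.norm_dγ,
      mul_inv_cancel₀ Θ.P_pos.ne']
  have hkp : levelCurvature e p = Θ.P ^ 2 * hessQuad e p v / ‖gradient e p‖ := by
    rw [levelCurvature_eq_of_finrank_eq_two hd (hgp θ) ht1
      (by rw [real_inner_smul_right, hpv θ, mul_zero]), hessQuad_smul']
  have hkq : levelCurvature e q = Θ.P ^ 2 * hessQuad e q v / ‖gradient e q‖ := by
    rw [levelCurvature_eq_of_finrank_eq_two hd (hgq θ) ht1
      (by rw [real_inner_smul_right, hqv θ, mul_zero]), hessQuad_smul']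
  have hlam_eq : lam = -(r * hessQuad e p v / hessQuad e q v) := by
    field_simp
    linarith
  have hratio : antipodeAngularDeriv e a Θ θ = r * hessQuad e p v / hessQuad e q v := by
    unfold antipodeAngularDeriv
    rw [← hp, ← hq, hkp, hkq, hr]
    have h1 : ‖gradient e p‖ ≠ 0 := norm_ne_zero_iff.2 (hgp θ)
    have h2 : ‖gradient e q‖ ≠ 0 := norm_ne_zero_iff.2 (hgq θ)
    have h3 : Θ.P ≠ 0 := Θ.P_pos.ne'
    field_simp
  rw [hlam, norm_smul, Real.norm_eq_abs, hlam_eq, abs_neg, hratio,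
    abs_of_pos (div_pos (mul_pos hrpos hposp) hposq)]

/-- (curvratio) in the form that links (A4) to (A4′): for the angular coordinate `Θ`, the quantity
`|∂_θ p|⁻¹ |∂_θ a(p(0,θ))|` of (A4) (`HypA4`, eq. (upplo) p.7 L71–85) equals the curvature ratio
`∂a/∂θ = κ(θ)/κ(a(θ))` of (A4′) (`antipodeAngularDeriv`), so (A4) reads `7/8 ≤ ∂a/∂θ ≤ 9/8`
((antidel) p.9 L89–92). [cite: FeldmanSalmhoferTrubowitz1998, §2.2 eqs. (antidel), (curvratio) (arXiv p.9 L86–104)] -/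
theorem FermiCurveParam.inv_norm_mul_norm_deriv_antipode_eq (hd : Module.finrank ℝ E = 2)
    {cr : Crystal E} {e : E → ℝ} {k : ℕ} {h : ℝ≥0} (hk : 2 ≤ k) (hA2 : HypA2 cr k h e)
    (hA3 : HypA3 e) (Θ : FermiCurveParam cr e) {a : E → E}
    (ha : IsAntipodalMapOn e (cr.fermiSurfaceRep e) a) {θ : ℝ} (hdγ : DifferentiableAt ℝ Θ.dγ θ)
    {b : E} (hb : HasDerivAt (fun t => a (Θ.γ t)) b θ) :
    ‖Θ.dγ θ‖⁻¹ * ‖b‖ = antipodeAngularDeriv e a Θ θ := by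
  rw [Θ.norm_deriv_antipode_eq hd hk hA2 hA3 ha hdγ hb, Θ.norm_dγ, inv_inv,
    mul_comm, mul_assoc, inv_mul_cancel₀ Θ.P_pos.ne', mul_one]

end Orientation

/-! ### The symmetric case (Sy): `a(p) = -p`, and (A4) holds trivially [II p.7 L73–77, L86–87] -/

section Symmetric

/-- For a symmetric band structure (`e(-p) = e(p)`, (Sy)) the gradient is odd: `∇e(-p) = -∇e(p)`.
[cite: FeldmanSalmhoferTrubowitz1998, §2.1 hypothesis (Sy) (arXiv p.7 L73–77)] -/
theorem HypSy.gradient_neg {e : E → ℝ} (hSy : HypSy e) (p : E) : gradient e (-p) = -gradient e p := by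
  have hcomp : (fun x => e (-x)) = e := funext fun x => hSy x
  have hnegd : ∀ q : E, HasFDerivAt (fun x : E => -x) (-ContinuousLinearMap.id ℝ E) q := fun q =>
    (hasFDerivAt_id q).neg
  by_cases hd : DifferentiableAt ℝ e p
  · -- differentiate `e = e ∘ neg` at `-p`
    have h1 : HasFDerivAt (fun x => e (-x)) ((fderiv ℝ e p).comp (-ContinuousLinearMap.id ℝ E))
        (-p) := by
      have h2 : HasFDerivAt e (fderiv ℝ e p) (-(-p)) := by rw [neg_neg]; exact hd.hasFDerivAt
      exact h2.comp (-p) (hnegd (-p))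
    rw [hcomp] at h1
    apply ext_inner_right ℝ
    intro x
    rw [inner_gradient_left, h1.fderiv, inner_neg_left, inner_gradient_left]
    simp
  · -- neither is `e` differentiable at `-p`; both gradients are the junk value `0`
    have hd' : ¬DifferentiableAt ℝ e (-p) := by
      intro h1
      apply hd
      have h2 : HasFDerivAt (fun x => e (-x)) ((fderiv ℝ e (-p)).comp (-ContinuousLinearMap.id ℝ E))
          p := h1.hasFDerivAt.comp p (hnegd p)
      rw [hcomp] at h2
      exact h2.differentiableAt
    rw [gradient_eq_zero_of_not_differentiableAt hd, gradient_eq_zero_of_not_differentiableAt hd',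
      neg_zero]

/-- (Sy) makes the unit normal odd: `n(-p) = -n(p)`.
[cite: FeldmanSalmhoferTrubowitz1998, §2.1 hypothesis (Sy) (arXiv p.7 L73–77)] -/
theorem HypSy.unitNormal_neg {e : E → ℝ} (hSy : HypSy e) (p : E) :
    unitNormal e (-p) = -unitNormal e p := by
  unfold unitNormal
  rw [hSy.gradient_neg, norm_neg, smul_neg]

omit [InnerProductSpace ℝ E] [CompleteSpace E] in
/-- (Sy) makes the Fermi surface symmetric: `-p ∈ S ↔ p ∈ S`.
[cite: FeldmanSalmhoferTrubowitz1998, §2.1 hypothesis (Sy) (arXiv p.7 L73–77)] -/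
theorem HypSy.neg_mem_fermiSurface {e : E → ℝ} (hSy : HypSy e) {p : E} :
    -p ∈ fermiSurface e ↔ p ∈ fermiSurface e := by
  rw [mem_fermiSurface, mem_fermiSurface, hSy]

/-- [II] p.7 L77: "If (Sy) holds, `a(p) = -p`": for a symmetric `e`, `p ↦ -p` is an antipodal map of
`S ∩ F`, provided the representatives are symmetric (`p ∈ S ∩ F ⇒ -p ∈ S ∩ F`, as when `S ∩ F ⊂ F̊` for
a symmetric fundamental domain — the situation of (A5), p.7 L95–96; recorded as a hypothesis).
[cite: FeldmanSalmhoferTrubowitz1998, §2.1 (arXiv p.7 L73–77)] -/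
theorem HypSy.isAntipodalMapOn_neg {cr : Crystal E} {e : E → ℝ} (hSy : HypSy e)
    (hneg : ∀ p ∈ cr.fermiSurfaceRep e, -p ∈ cr.fermiSurfaceRep e) :
    IsAntipodalMapOn e (cr.fermiSurfaceRep e) (fun p => -p) := fun p hp =>
  ⟨hneg p hp, hp.1, (hneg p hp).1, hSy.unitNormal_neg p⟩

/-- [II] p.7 L86–87: "If `e` is symmetric, (A4) holds trivially by (Sy) (the left hand side of (upplo)
is zero)": with the antipodal map `a(p) = -p`, along any curve `γ` in `S ∩ F` one has
`∂_t a(γ(t)) = -∂_t γ(t)`, so `|1 - |∂_t γ|⁻¹ |∂_t a(γ(t))|| = 0 ≤ 1/8`. Hypotheses: (Sy) and symmetric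
representatives (`p ∈ S ∩ F ⇒ -p ∈ S ∩ F`).
[cite: FeldmanSalmhoferTrubowitz1998, Assumption A4 eq. (upplo) (arXiv p.7 L78–87)] -/
theorem HypSy.hypA4 {cr : Crystal E} {e : E → ℝ} (hSy : HypSy e)
    (hneg : ∀ p ∈ cr.fermiSurfaceRep e, -p ∈ cr.fermiSurfaceRep e) : HypA4 cr e := by
  refine ⟨fun p => -p, hSy.isAntipodalMapOn_neg hneg, ?_⟩
  intro γ t γ' b _ hγ hb hγ'
  have hb' : HasDerivAt ((fun p : E => -p) ∘ γ) (-γ') t := by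
    have : ((fun p : E => -p) ∘ γ) = fun s => -γ s := rfl
    rw [this]
    exact hγ.neg
  have hbeq : b = -γ' := hb.unique hb'
  rw [hbeq, norm_neg, inv_mul_cancel₀ (norm_ne_zero_iff.2 hγ'), sub_self, abs_zero]
  norm_num

end Symmetric

end Literature.MathematicalPhysics.QuantumLattice.FermiRG

end
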